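import Literature.Analysis.FluidPDE.PlanarRedescription
import Literature.Analysis.FluidPDE.PlanarJunctionAgreement2
import HarnessLib

/-!
# Re-description, second layer: covers involving sheared diagonal graph bands

Topic `Literature/Analysis/FluidPDE`. `PlanarRedescription.lean` glues consecutive first-layer
phases in time: at a frozen instant the two assembled scalars coincide when every node of either
phase is covered, piece by piece, by nodes of the other with equivalence certificates
(`certOnPieceB`, `redescribeB`, `fields_eq_of_redescribeB`). This file extends the certificates to
second-layer elements (`ElemQ2`): `EquivCert2 := base EquivCert | viaDg … | shLocalXi …`, where

* `base c` — two first-layer elements, the certificate `c`;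
* `viaDg c …` — the certificate `c` between the MATERIAL views (`toElemQ`: a sheared band replaced
  by the diagonal band of its data) together with, for each sheared side, the piece test
  `shPieceOKB` (the piece's abscissa interval widened by `μ = |sh| · B` inside a material gap at the
  frozen end, `B` a certified bound of the transverse offset over the cover rectangle), under which
  the sheared scalar IS the scalar of its data on the piece (`PlanarTypedElements2.scalar_eq_dScalar`);
* `viaDgB c …` — as `viaDg` but with BAND-BOUNDED gap tests (the offset is within `r₀ · whi` wherever
  the covered scalar is nonzero, which is where certificates are used): no line data, arcs allowed;
* `sameTGap …` — material views of the same shape (same frozen line data) in frozen material gaps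
  of equal slope, with the band-bounded tests of the sheared sides (arcs after a width change);
* `shLocalXi …` — a run against a sheared band on its UNSHEARED arm (`SDgQ.shRunMatchB`: in the
  unnormalised diagonal frame the sheared abscissa along an arm of slope `W = ±1` with shear `W/2`
  is the arm's axial coordinate and the transverse offset is twice the distance to the arm, so the
  sheared scalar is the scalar of a run whose width is the half-shift of `Ξ` — whatever the material
  regime, in particular across a width KINK, which a plain diagonal band cannot hand over to a run).

and re-proves the phase-level re-description theorem for second-layer phases along the lines of the
first layer: pieces, tubes and boxes are read on the views (identical geometry), element scalars are
the second-layer ones (`scalar_eq_of_certOnPiece2B`, `redescribeB2`, `fields_eq_of_redescribeB2`).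

Folklore; no named facts. Infrastructure towards a discharge of `acm_compatible_blocks`
(`QuasiSelfSimilarCompatibleBlocks.lean`).

## References

* G. Alberti, G. Crippa, A. L. Mazzucato, *Exponential self-similar mixing by incompressible
  flows*, J. Amer. Math. Soc. 32 (2019), 445–490, §7 (arXiv:1605.02090).
-/

noncomputable section

open Function Set Filter
open scoped Topology ContDiff

namespace Literature.Analysis.FluidPDE

namespace PlanarKinematics

open Gluing

/-- The plane `ℝ²` as a Euclidean space. [folklore] -/
local notation "E²" => EuclideanSpace ℝ (Fin 2)

/-! ## Bound of an affine functional over a rational rectangle at a frozen end -/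

namespace LinFun

variable (φ : LinFun)

/-- Corner value at the end `b`. [folklore] -/
def cornerAtEnd (x y : ℚ) (b : Bool) : ℚ := φ.f0 * x + φ.f1 * y + φ.g.atEnd b

/-- **Certified bound of `|φ|` at the end `b` over a rational rectangle** (maximum over the corners).
[folklore] -/
def rectBoundAt (φ : LinFun) (R : RectQ) (b : Bool) : ℚ :=
  max (max |φ.cornerAtEnd (R.lo 0) (R.lo 1) b| |φ.cornerAtEnd (R.lo 0) (R.hi 1) b|)
    (max |φ.cornerAtEnd (R.hi 0) (R.lo 1) b| |φ.cornerAtEnd (R.hi 0) (R.hi 1) b|)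

/-- **Soundness of the rectangle bound.** [folklore] -/
theorem abs_eval_le_rectBoundAt (R : RectQ) (b : Bool) {z : E²} (hz : R.mem z) :
    |φ.eval (endVal b) z| ≤ φ.rectBoundAt R b := by
  have hb : ∀ x y : ℚ, ((|φ.cornerAtEnd x y b| : ℚ) : ℝ) ≤ φ.rectBoundAt R b →
      -(φ.rectBoundAt R b : ℝ) ≤ (φ.f0 : ℝ) * x + (φ.f1 : ℝ) * y + (φ.g.atEnd b : ℝ) ∧
        (φ.f0 : ℝ) * x + (φ.f1 : ℝ) * y + (φ.g.atEnd b : ℝ) ≤ φ.rectBoundAt R b := by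
    intro x y hle
    have h : |((φ.f0 : ℝ) * x + (φ.f1 : ℝ) * y + (φ.g.atEnd b : ℝ))| ≤ φ.rectBoundAt R b := by
      have e : ((|φ.cornerAtEnd x y b| : ℚ) : ℝ) = |((φ.f0 : ℝ) * x + (φ.f1 : ℝ) * y + (φ.g.atEnd b : ℝ))| := by
        rw [cornerAtEnd]; push_cast; rfl
      rw [← e]; exact hle
    exact abs_le.1 h
  have e1 : ((|φ.cornerAtEnd (R.lo 0) (R.lo 1) b| : ℚ) : ℝ) ≤ φ.rectBoundAt R b := by
    exact_mod_cast (le_max_of_le_left (le_max_left _ _) : |φ.cornerAtEnd (R.lo 0) (R.lo 1) b| ≤ φ.rectBoundAt R b)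
  have e2 : ((|φ.cornerAtEnd (R.lo 0) (R.hi 1) b| : ℚ) : ℝ) ≤ φ.rectBoundAt R b := by
    exact_mod_cast (le_max_of_le_left (le_max_right _ _) : |φ.cornerAtEnd (R.lo 0) (R.hi 1) b| ≤ φ.rectBoundAt R b)
  have e3 : ((|φ.cornerAtEnd (R.hi 0) (R.lo 1) b| : ℚ) : ℝ) ≤ φ.rectBoundAt R b := by
    exact_mod_cast (le_max_of_le_right (le_max_left _ _) : |φ.cornerAtEnd (R.hi 0) (R.lo 1) b| ≤ φ.rectBoundAt R b)
  have e4 : ((|φ.cornerAtEnd (R.hi 0) (R.hi 1) b| : ℚ) : ℝ) ≤ φ.rectBoundAt R b := by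
    exact_mod_cast (le_max_of_le_right (le_max_right _ _) : |φ.cornerAtEnd (R.hi 0) (R.hi 1) b| ≤ φ.rectBoundAt R b)
  obtain ⟨l1, u1⟩ := hb _ _ e1; obtain ⟨l2, u2⟩ := hb _ _ e2; obtain ⟨l3, u3⟩ := hb _ _ e3; obtain ⟨l4, u4⟩ := hb _ _ e4
  rw [abs_le, LinFun.eval, Aff.eval_endVal]
  obtain ⟨ha0, hb0⟩ := hz 0; obtain ⟨ha1, hb1⟩ := hz 1
  set X := z 0; set Y := z 1
  set A0 : ℝ := ((R.lo 0 : ℚ) : ℝ); set B0 : ℝ := ((R.hi 0 : ℚ) : ℝ); set A1 : ℝ := ((R.lo 1 : ℚ) : ℝ); set B1 : ℝ := ((R.hi 1 : ℚ) : ℝ)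
  set f0 : ℝ := (φ.f0 : ℝ); set f1 : ℝ := (φ.f1 : ℝ)
  have hX : min (f0 * A0) (f0 * B0) ≤ f0 * X ∧ f0 * X ≤ max (f0 * A0) (f0 * B0) := by
    rcases le_total 0 f0 with hf | hf
    · exact ⟨(min_le_left _ _).trans (mul_le_mul_of_nonneg_left ha0 hf), (mul_le_mul_of_nonneg_left hb0 hf).trans (le_max_right _ _)⟩
    · exact ⟨(min_le_right _ _).trans (mul_le_mul_of_nonpos_left hb0 hf), (mul_le_mul_of_nonpos_left ha0 hf).trans (le_max_left _ _)⟩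
  have hY : min (f1 * A1) (f1 * B1) ≤ f1 * Y ∧ f1 * Y ≤ max (f1 * A1) (f1 * B1) := by
    rcases le_total 0 f1 with hf | hf
    · exact ⟨(min_le_left _ _).trans (mul_le_mul_of_nonneg_left ha1 hf), (mul_le_mul_of_nonneg_left hb1 hf).trans (le_max_right _ _)⟩
    · exact ⟨(min_le_right _ _).trans (mul_le_mul_of_nonpos_left hb1 hf), (mul_le_mul_of_nonpos_left ha1 hf).trans (le_max_left _ _)⟩
  constructor
  · rcases min_choice (f0 * A0) (f0 * B0) with hm0 | hm0 <;> rcases min_choice (f1 * A1) (f1 * B1) with hm1 | hm1 <;>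
      [linarith [hX.1, hY.1]; linarith [hX.1, hY.1]; linarith [hX.1, hY.1]; linarith [hX.1, hY.1]]
  · rcases max_choice (f0 * A0) (f0 * B0) with hm0 | hm0 <;> rcases max_choice (f1 * A1) (f1 * B1) with hm1 | hm1 <;>
      [linarith [hX.2, hY.2]; linarith [hX.2, hY.2]; linarith [hX.2, hY.2]; linarith [hX.2, hY.2]]

end LinFun

/-! ## The piece test of a sheared node at a frozen end -/

namespace SDgQ

variable (s : SDgQ)

/-- **Piece test of a sheared node at the end `b`**: line data available on the line gap `mT`, and
the abscissa interval `[ua, ub]` widened by `μ = |sh| · rectBound` inside the gap pair `(mT, mΞ)` at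
the end (tested on the diagonal band of the data). [folklore] -/
def shPieceOKB (s : SDgQ) (b : Bool) (mT mΞ : ℕ) (ua ub : ℚ) (R : RectQ) : Bool :=
  match s.lineData mT with
  | none => false
  | some (C, W) =>
    (ElemQ.dg s.d).gapSideB b mT mΞ (ua - |s.sh| * (s.offsetFun C W).rectBoundAt R b)
      (ub + |s.sh| * (s.offsetFun C W).rectBoundAt R b)

variable {s}

/-- **Soundness of the piece test**: at a frozen instant, on the rectangle, with abscissa in the
interval, the sheared scalar is the scalar of the node's data. [folklore] -/
theorem scalar_eq_d_of_shPieceOKB (hv : s.validB = true) {b : Bool} {mT mΞ : ℕ} {ua ub : ℚ} {R : RectQ}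
    (h : s.shPieceOKB b mT mΞ ua ub R = true) {t₀ τ t : ℝ} (ht : clock t₀ τ t = endVal b) {z : E²} (hz : R.mem z)
    (hu : (ua : ℝ) ≤ (ElemQ.dg s.d).uOf z ∧ (ElemQ.dg s.d).uOf z ≤ ub) (G : ℝ → ℝ) :
    s.scalar t₀ τ G t z = s.d.scalar t₀ τ G t z := by
  have hvd := validD_of_validB hv
  have hF : s.d.Ξ.LenPos := Pw.lenPos_of_matValidB (DgQ.matValid_of_validB hvd)
  simp only [shPieceOKB] at h
  cases hL : s.lineData mT with
  | none => rw [hL] at h; simp at h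
  | some CW =>
    obtain ⟨C, W⟩ := CW
    rw [hL] at h
    simp only at h
    set μ : ℝ := ((|s.sh| * (s.offsetFun C W).rectBoundAt R b : ℚ) : ℝ) with hμ
    set u := (ElemQ.dg s.d).uOf z with hudef
    set w := diagFrame ((d4Frame s.d.o).app z) with hw
    have hw0 : w 0 = u := by rw [hudef, ElemQ.uOf_dg]
    have hw1 : w 1 = (ElemQ.dg s.d).vOf z := by rw [ElemQ.vOf_dg]
    -- gaps on the widened interval at the end
    have hgap : ∀ u' ∈ Icc (u - μ) (u + μ), (ElemQ.dg s.d).LineGap mT (endVal b) u' ∧ s.d.Ξ.InGap mΞ (endVal b) u' := by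
      intro u' hu'
      have h3 := ElemQ.gaps_of_gapSideB h (u := u') ⟨by push_cast; rw [hμ] at hu'; push_cast at hu'; linarith [hu.1, hu'.1],
        by push_cast; rw [hμ] at hu'; push_cast at hu'; linarith [hu.2, hu'.2]⟩
      exact ⟨h3.1, h3.2.1⟩
    have hμ0 : (0 : ℝ) ≤ μ := by
      rw [hμ]
      have hr : (0 : ℚ) ≤ (s.offsetFun C W).rectBoundAt R b := by
        simp only [LinFun.rectBoundAt]; exact le_max_of_le_left (le_max_of_le_left (abs_nonneg _))
      exact_mod_cast mul_nonneg (abs_nonneg _) hr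
    have hu0 := hgap u ⟨by linarith, by linarith⟩
    -- the offset on the rectangle
    have hTf : s.Tf (w 0) = C + W * u := by
      rw [hw0, SDgQ.Tf, ← Pw.cval_static (t₀ := t₀) (τ := τ) (static_of_validB hv) t u]
      have hl := line_eq_of_lineData hv hL (α := endVal b) (u := u) hu0.1
      simp only [ElemQ.line] at hl
      simp only [Pw.cval, ht, hl]
    have hoff : w 1 - s.Tf (w 0) = (s.offsetFun C W).eval (endVal b) z := by rw [hTf, hw1, offsetFun_eval]
    have hbound : |(s.sh : ℝ)| * |w 1 - s.Tf (w 0)| ≤ μ := by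
      rw [hoff, hμ]; push_cast
      exact mul_le_mul_of_nonneg_left ((s.offsetFun C W).abs_eval_le_rectBoundAt R b hz) (abs_nonneg _)
    have hW : ∀ u' ∈ Icc (u - μ) (u + μ), s.d.Ξ.cdu t₀ τ t u' = s.d.Ξ.cdu t₀ τ t u' := fun _ _ => rfl
    have hW' : ∀ u' ∈ Icc (u - μ) (u + μ), s.d.Ξ.cdu t₀ τ t u' = s.d.Ξ.cdu t₀ τ t u := by
      intro u' hu'
      simp only [Pw.cdu, ht]
      rw [s.d.Ξ.du_eq_W hF (hgap u' hu').2, s.d.Ξ.du_eq_W hF hu0.2]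
    refine scalar_eq_dScalar hv G ?_
    have := cdu_shAbscissa_eq (e := s) (t₀ := t₀) (τ := τ) (t := t) hw0 hW' hbound
    rw [hw0] at this ⊢; exact this

end SDgQ

/-! ## The run ↔ sheared-transition certificate (`shLocalXi`)

In the unnormalised diagonal frame `u = x - y, v = x + y` a sheared band on a piece where its line is
in gap `mT` with slope `W = ±1`, intercept `C`, and shear `sh = W/2`, has transverse offset
`v - T(u) = 2y - C` (`W = 1`) resp. `2x - C` (`W = -1`) and sheared abscissa `ξ = x - C/2` resp.
`-(y - C/2)`: its scalar is that of a RUN along the arm whose width profile is the half-shift of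
`Ξ` (`Ξ'ₓ(x') = Ξₓ(x' - C/2)/2`, run frame `x' = x, y' = σ y` for `W = 1`; `x' = -y, y' = σ x` for
`W = -1`) and whose line is the constant `σ C/2`. -/

namespace Pw

/-- **Half-shift test on frozen width data**: `Ξ'` at end `b'` has half the base slope of `Ξ` at
end `b` and the kinks of `Ξ` shifted by `c` with halved jumps. [folklore] -/
def halfShiftB (Ξ : Pw) (b : Bool) (Ξ' : Pw) (b' : Bool) (c : ℚ) : Bool :=
  decide (Ξ'.s.atEnd b' = Ξ.s.atEnd b / 2) &&
    decide (Ξ'.frzKinks b' = (Ξ.frzKinks b).map fun q => (q.1 + c, q.2.1 / 2, q.2.2))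

/-- A shifted kink datum with halved jump has half the slope at the shifted abscissa. [folklore] -/
theorem duQ_halfShift (q : ℚ × ℚ × ℚ) (c : ℚ) (x : ℝ) :
    Kink.duQ (q.1 + c, q.2.1 / 2, q.2.2) x = Kink.duQ q (x - c) / 2 := by
  simp only [Kink.duQ]; push_cast; ring_nf

/-- **Soundness of the half-shift test.** [folklore] -/
theorem du_of_halfShiftB {Ξ Ξ' : Pw} {b b' : Bool} {c : ℚ} (h : Ξ.halfShiftB b Ξ' b' c = true) (x : ℝ) :
    Ξ'.du (endVal b') x = Ξ.du (endVal b) (x - c) / 2 := by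
  simp only [halfShiftB, Bool.and_eq_true, decide_eq_true_eq] at h
  obtain ⟨hs, hk⟩ := h
  rw [Ξ'.du_endVal, Ξ.du_endVal, hk, hs, List.map_map]
  have hsum : ∀ L : List (ℚ × ℚ × ℚ),
      (L.map ((fun q => Kink.duQ q x) ∘ fun q => (q.1 + c, q.2.1 / 2, q.2.2))).sum = (L.map fun q => Kink.duQ q (x - c)).sum / 2 := by
    intro L
    induction L with
    | nil => simp
    | cons q rest ih => simp only [List.map_cons, List.sum_cons, Function.comp, duQ_halfShift] at ih ⊢; rw [ih]; ring
  rw [hsum]; push_cast; ring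

/-! ### Windowed half-shift: the comparison restricted to the kinks whose ramps meet a window -/

/-- A frozen kink datum's ramp lies entirely below the window start `xa` (its slope is the full jump
on the window). [folklore] -/
def qBeforeB (q : ℚ × ℚ × ℚ) (xa : ℚ) : Bool := decide (q.1 + 2 * q.2.2 / 3 ≤ xa)

/-- A frozen kink datum's ramp lies entirely above the window end `xb` (its slope vanishes on the
window). [folklore] -/
def qAfterB (q : ℚ × ℚ × ℚ) (xb : ℚ) : Bool := decide (xb ≤ q.1 + q.2.2 / 3)

/-- The slope of a kink datum below the window is its jump. [folklore] -/
theorem duQ_of_qBeforeB {q : ℚ × ℚ × ℚ} {xa : ℚ} (h : qBeforeB q xa = true) (hℓ : 0 < q.2.2) {x : ℝ} (hx : (xa : ℝ) ≤ x) :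
    Kink.duQ q x = q.2.1 := by
  simp only [qBeforeB, decide_eq_true_eq] at h
  have hℓ' : (0 : ℝ) < q.2.2 := by exact_mod_cast hℓ
  have h' : ((q.1 + 2 * q.2.2 / 3 : ℚ) : ℝ) ≤ xa := by exact_mod_cast h
  push_cast at h'
  rw [Kink.duQ, step_of_ge, mul_one]
  rw [le_div_iff₀ hℓ']; linarith

/-- The slope of a kink datum above the window vanishes. [folklore] -/
theorem duQ_of_qAfterB {q : ℚ × ℚ × ℚ} {xb : ℚ} (h : qAfterB q xb = true) (hℓ : 0 < q.2.2) {x : ℝ} (hx : x ≤ (xb : ℝ)) :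
    Kink.duQ q x = 0 := by
  simp only [qAfterB, decide_eq_true_eq] at h
  have hℓ' : (0 : ℝ) < q.2.2 := by exact_mod_cast hℓ
  have h' : ((xb : ℚ) : ℝ) ≤ ((q.1 + q.2.2 / 3 : ℚ) : ℝ) := by exact_mod_cast h
  push_cast at h'
  rw [Kink.duQ, step_of_le, mul_zero]
  rw [div_le_iff₀ hℓ']; linarith

/-- Sum of a mapped list split by a Boolean predicate. [folklore] -/
theorem sum_map_split {α : Type*} (L : List α) (p : α → Bool) (f : α → ℝ) :
    (L.map f).sum = ((L.filter p).map f).sum + ((L.filter fun a => !p a).map f).sum := by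
  induction L with
  | nil => simp
  | cons a rest ih =>
    simp only [List.map_cons, List.sum_cons, List.filter_cons]
    cases p a <;> simp [ih] <;> ring

/-- On the window, the kinks below it contribute their jumps. [folklore] -/
theorem sum_duQ_before (L : List (ℚ × ℚ × ℚ)) (lo : ℚ) {y : ℝ} (hℓ : ∀ q ∈ L, 0 < q.2.2) (hy : (lo : ℝ) ≤ y) :
    ((L.filter fun q => qBeforeB q lo).map fun q => Kink.duQ q y).sum =
      ((((L.filter fun q => qBeforeB q lo).map fun q => q.2.1).sum : ℚ) : ℝ) := by
  induction L with
  | nil => simp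
  | cons q rest ih =>
    have hr : ∀ q' ∈ rest, 0 < q'.2.2 := fun q' hq' => hℓ q' (List.mem_cons_of_mem _ hq')
    simp only [List.filter_cons]
    cases hq : qBeforeB q lo with
    | false => simpa using ih hr
    | true =>
      simp only [List.map_cons, List.sum_cons, ↓reduceIte]
      rw [ih hr, duQ_of_qBeforeB hq (hℓ q (List.mem_cons_self)) hy]
      push_cast; ring

/-- A mapped sum all of whose terms vanish. [folklore] -/
theorem sum_map_eq_zero {α : Type*} (L : List α) (f : α → ℝ) (h : ∀ a ∈ L, f a = 0) : (L.map f).sum = 0 :=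
  List.sum_eq_zero fun x hx => by obtain ⟨a, ha, rfl⟩ := List.mem_map.1 hx; exact h a ha

/-- The shifted, halved kinks have half the slopes at the shifted abscissa (summed). [folklore] -/
theorem sum_duQ_halfShift (M : List (ℚ × ℚ × ℚ)) (c : ℚ) (x : ℝ) :
    ((M.map fun q => (q.1 + c, q.2.1 / 2, q.2.2)).map fun q => Kink.duQ q x).sum = (M.map fun q => Kink.duQ q (x - c)).sum / 2 := by
  induction M with
  | nil => simp
  | cons q rest ih => simp only [List.map_cons, List.sum_cons] at ih ⊢; rw [ih, duQ_halfShift]; ring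

/-- **The frozen slope function on a window**: level entering the window plus the kinks meeting it. [folklore] -/
theorem du_endVal_window (F : Pw) (e : Bool) {lo hi : ℚ} {y : ℝ} (hℓ : ∀ q ∈ F.frzKinks e, 0 < q.2.2)
    (hy : (lo : ℝ) ≤ y ∧ y ≤ hi) :
    F.du (endVal e) y = (((F.s.atEnd e + (((F.frzKinks e).filter fun q => qBeforeB q lo).map fun q => q.2.1).sum : ℚ)) : ℝ) +
      (((F.frzKinks e).filter fun q => !qAfterB q hi && !qBeforeB q lo).map fun q => Kink.duQ q y).sum := by
  rw [F.du_endVal]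
  set L := F.frzKinks e
  rw [sum_map_split L (fun q => qBeforeB q lo) (fun q => Kink.duQ q y), sum_duQ_before L lo hℓ hy.1,
    sum_map_split (L.filter fun q => !qBeforeB q lo) (fun q => qAfterB q hi) (fun q => Kink.duQ q y),
    List.filter_filter, List.filter_filter]
  have h0 : ((L.filter fun q => qAfterB q hi && !qBeforeB q lo).map fun q => Kink.duQ q y).sum = 0 :=
    sum_map_eq_zero _ _ fun q hq => by
      obtain ⟨hqL, hp⟩ := List.mem_filter.1 hq
      simp only [Bool.and_eq_true] at hp
      exact duQ_of_qAfterB hp.1 (hℓ q hqL) hy.2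
  rw [h0, zero_add]
  push_cast [Rat.cast_list_sum, List.map_map]
  ring

/-- **Windowed half-shift test**: on the window `[xa, xb]` the frozen slope function of `Ξ'` at end
`b'` is half the frozen slope function of `Ξ` at end `b` shifted by `c`: the kinks meeting the windows
(neither below nor above) correspond under the shift with halved jumps, and the slope levels entering
the windows are in ratio `2 : 1`; all kink lengths positive. [folklore] -/
def halfShiftOnB (Ξ : Pw) (b : Bool) (Ξ' : Pw) (b' : Bool) (c xa xb : ℚ) : Bool :=
  let K := Ξ.frzKinks b
  let K' := Ξ'.frzKinks b'
  (K.all fun q => decide (0 < q.2.2)) && (K'.all fun q => decide (0 < q.2.2)) &&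
    decide ((K'.filter fun q => !qAfterB q xb && !qBeforeB q xa) =
      (K.filter fun q => !qAfterB q (xb - c) && !qBeforeB q (xa - c)).map fun q => (q.1 + c, q.2.1 / 2, q.2.2)) &&
    decide (Ξ'.s.atEnd b' + ((K'.filter fun q => qBeforeB q xa).map fun q => q.2.1).sum =
      (Ξ.s.atEnd b + ((K.filter fun q => qBeforeB q (xa - c)).map fun q => q.2.1).sum) / 2)

/-- **Soundness of the windowed half-shift test.** [folklore] -/
theorem du_of_halfShiftOnB {Ξ Ξ' : Pw} {b b' : Bool} {c xa xb : ℚ} (h : Ξ.halfShiftOnB b Ξ' b' c xa xb = true) {x : ℝ}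
    (hx : (xa : ℝ) ≤ x ∧ x ≤ xb) : Ξ'.du (endVal b') x = Ξ.du (endVal b) (x - c) / 2 := by
  simp only [halfShiftOnB, Bool.and_eq_true, List.all_eq_true, decide_eq_true_eq] at h
  obtain ⟨⟨⟨hℓ, hℓ'⟩, hmeet⟩, hlev⟩ := h
  have hx' : ((xa - c : ℚ) : ℝ) ≤ x - c ∧ x - c ≤ ((xb - c : ℚ) : ℝ) := by push_cast; exact ⟨by linarith [hx.1], by linarith [hx.2]⟩
  rw [Ξ'.du_endVal_window b' hℓ' hx, Ξ.du_endVal_window b hℓ hx', hmeet, sum_duQ_halfShift, hlev]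
  push_cast; ring

end Pw

namespace SDgQ

/-- **The sheared scalar in frame coordinates.** [folklore] -/
theorem scalar_frame (s : SDgQ) (t₀ τ : ℝ) (G : ℝ → ℝ) (t : ℝ) (z : E²) :
    s.scalar t₀ τ G t z =
      G (((ElemQ.dg s.d).vOf z - s.Tf ((ElemQ.dg s.d).uOf z)) /
        s.d.Ξ.du (clock t₀ τ t) ((ElemQ.dg s.d).uOf z + s.sh * ((ElemQ.dg s.d).vOf z - s.Tf ((ElemQ.dg s.d).uOf z)))) := by
  simp [SDgQ.scalar, LinFrame.conjScalar_apply, shCornerScalar_apply, ElemQ.vOf_dg, ElemQ.uOf_dg, Pw.cdu, diagFrame_apply,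
    vec2_apply_zero, vec2_apply_one]

/-- **Range of an integer linear form over a rational rectangle** (min / max over the corners). [folklore] -/
def _root_.Literature.Analysis.FluidPDE.PlanarKinematics.RectQ.linRange (R : RectQ) (f0 f1 : ℤ) : ℚ × ℚ :=
  let v := fun (x y : ℚ) => (f0 : ℚ) * x + (f1 : ℚ) * y
  (min (min (v (R.lo 0) (R.lo 1)) (v (R.lo 0) (R.hi 1))) (min (v (R.hi 0) (R.lo 1)) (v (R.hi 0) (R.hi 1))),
    max (max (v (R.lo 0) (R.lo 1)) (v (R.lo 0) (R.hi 1))) (max (v (R.hi 0) (R.lo 1)) (v (R.hi 0) (R.hi 1))))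

/-- **Soundness of the range**: on the rectangle the form lies in the range. [folklore] -/
theorem _root_.Literature.Analysis.FluidPDE.PlanarKinematics.RectQ.mem_linRange (R : RectQ) (f0 f1 : ℤ) {z : E²} (hz : R.mem z) :
    ((R.linRange f0 f1).1 : ℝ) ≤ (f0 : ℝ) * z 0 + (f1 : ℝ) * z 1 ∧ (f0 : ℝ) * z 0 + (f1 : ℝ) * z 1 ≤ ((R.linRange f0 f1).2 : ℝ) := by
  obtain ⟨hx0, hx1⟩ := hz 0
  obtain ⟨hy0, hy1⟩ := hz 1
  have key := linear_mem_of_corners (a := (f0 : ℝ)) (b := (f1 : ℝ)) (lo := ((R.linRange f0 f1).1 : ℝ)) (hi := ((R.linRange f0 f1).2 : ℝ))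
    ⟨hx0, hx1⟩ ⟨hy0, hy1⟩
  have hc : ∀ x y : ℚ, (x = R.lo 0 ∨ x = R.hi 0) → (y = R.lo 1 ∨ y = R.hi 1) →
      ((R.linRange f0 f1).1 : ℝ) ≤ (f0 : ℝ) * x + (f1 : ℝ) * y ∧ (f0 : ℝ) * x + (f1 : ℝ) * y ≤ ((R.linRange f0 f1).2 : ℝ) := by
    intro x y hx hy
    have h1 : (R.linRange f0 f1).1 ≤ (f0 : ℚ) * x + (f1 : ℚ) * y := by
      simp only [RectQ.linRange]
      rcases hx with rfl | rfl <;> rcases hy with rfl | rfl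
      · exact min_le_of_left_le (min_le_left _ _)
      · exact min_le_of_left_le (min_le_right _ _)
      · exact min_le_of_right_le (min_le_left _ _)
      · exact min_le_of_right_le (min_le_right _ _)
    have h2 : (f0 : ℚ) * x + (f1 : ℚ) * y ≤ (R.linRange f0 f1).2 := by
      simp only [RectQ.linRange]
      rcases hx with rfl | rfl <;> rcases hy with rfl | rfl
      · exact le_max_of_le_left (le_max_left _ _)
      · exact le_max_of_le_left (le_max_right _ _)
      · exact le_max_of_le_right (le_max_left _ _)
      · exact le_max_of_le_right (le_max_right _ _)
    constructor
    · have := (Rat.cast_le (K := ℝ)).2 h1; push_cast at this; exact this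
    · have := (Rat.cast_le (K := ℝ)).2 h2; push_cast at this; exact this
  exact key (hc _ _ (Or.inl rfl) (Or.inl rfl)) (hc _ _ (Or.inl rfl) (Or.inr rfl)) (hc _ _ (Or.inr rfl) (Or.inl rfl))
    (hc _ _ (Or.inr rfl) (Or.inr rfl))

/-- **Run-match test** of a sheared band (end `b`, line gap `mT`, piece `[ua, ub]`) against a run
`r` (end `b'`): slope `W = ±1`, shear `W/2`, line gap on the piece, frame rows of the run expressed
in those of the band (`W = 1`: `x' = x`, `y' = σ y`; `W = -1`: `x' = -y`, `y' = σ x`), the run's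
line (an affine function of the clock) the constant `σ C/2` at the end, the run's width the half-shift of `Ξ` by `C/2` (`W = 1`) resp. `-C/2`
(`W = -1`) ON THE WINDOW of run abscissae over the cover rectangle `R` (`halfShiftOnB`). [folklore] -/
def shRunMatchB (s : SDgQ) (b : Bool) (mT : ℕ) (ua ub : ℚ) (r : RunQ) (b' : Bool) (R : RectQ) : Bool :=
  match s.lineData mT with
  | none => false
  | some (C, W) =>
    let win := R.linRange (d4a r.o) (d4b r.o)          -- the run's abscissa range over the cover rectangle
    let xr : ℤ × ℤ := (d4a s.d.o, d4b s.d.o)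
    let yr : ℤ × ℤ := (d4c s.d.o, d4d s.d.o)
    let xr' : ℤ × ℤ := (d4a r.o, d4b r.o)
    let yr' : ℤ × ℤ := (d4c r.o, d4d r.o)
    decide (2 * s.sh = W) && s.d.T.gapAtEndB mT b ua ub &&
      ((decide (W = 1) && decide (xr' = xr) &&
          ((decide (yr' = yr) && decide (r.y.atEnd b' = C / 2)) || (decide (yr' = (-yr.1, -yr.2)) && decide (r.y.atEnd b' = -(C / 2)))) &&
          s.d.Ξ.halfShiftOnB b r.Ξ b' (C / 2) win.1 win.2) ||
        (decide (W = -1) && decide (xr' = (-yr.1, -yr.2)) &&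
          ((decide (yr' = xr) && decide (r.y.atEnd b' = C / 2)) || (decide (yr' = (-xr.1, -xr.2)) && decide (r.y.atEnd b' = -(C / 2)))) &&
          s.d.Ξ.halfShiftOnB b r.Ξ b' (-(C / 2)) win.1 win.2))

/-- Frame coordinates of the band: `x, y` with `u = x - y`, `v = x + y`. [folklore] -/
theorem uOf_vOf_dg (d : DgQ) (z : E²) :
    (ElemQ.dg d).uOf z = ((d4a d.o : ℝ) * z 0 + (d4b d.o : ℝ) * z 1) - ((d4c d.o : ℝ) * z 0 + (d4d d.o : ℝ) * z 1) ∧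
      (ElemQ.dg d).vOf z = ((d4a d.o : ℝ) * z 0 + (d4b d.o : ℝ) * z 1) + ((d4c d.o : ℝ) * z 0 + (d4d d.o : ℝ) * z 1) := by
  simp only [ElemQ.uOf, ElemQ.vOf, ElemQ.uC, ElemQ.vC]; push_cast; constructor <;> ring

/-- Frame coordinates of a run. [folklore] -/
theorem uOf_vOf_run (r : RunQ) (z : E²) :
    (ElemQ.run r).uOf z = (d4a r.o : ℝ) * z 0 + (d4b r.o : ℝ) * z 1 ∧ (ElemQ.run r).vOf z = (d4c r.o : ℝ) * z 0 + (d4d r.o : ℝ) * z 1 := by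
  constructor <;> simp [ElemQ.uOf, ElemQ.vOf, ElemQ.uC, ElemQ.vC]

/-- **Soundness of the run-match test**: at frozen instants the sheared scalar on the piece is the
run scalar. [folklore] -/
theorem scalar_eq_run_of_shRunMatchB {s : SDgQ} (hv : s.validB = true) {b b' : Bool} {mT : ℕ} {ua ub : ℚ} {r : RunQ} {R : RectQ}
    (h : s.shRunMatchB b mT ua ub r b' R = true) {G : ℝ → ℝ} (hGe : ∀ x, G (-x) = G x) {t₀ τ t₀' τ' t t' : ℝ}
    (ht : clock t₀ τ t = endVal b) (ht' : clock t₀' τ' t' = endVal b') {z : E²} (hz : R.mem z)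
    (hu : (ua : ℝ) ≤ (ElemQ.dg s.d).uOf z ∧ (ElemQ.dg s.d).uOf z ≤ ub) :
    s.scalar t₀ τ G t z = (ElemQ.run r).scalar t₀' τ' G t' z := by
  simp only [shRunMatchB] at h
  cases hL : s.lineData mT with
  | none => rw [hL] at h; simp at h
  | some CW =>
    obtain ⟨C, W⟩ := CW
    rw [hL] at h
    simp only [Bool.and_eq_true, Bool.or_eq_true, decide_eq_true_eq] at h
    obtain ⟨⟨hsh, hgap⟩, hcases⟩ := h
    -- the run's abscissa lies in the window over the cover rectangle
    have hwin := R.mem_linRange (d4a r.o) (d4b r.o) hz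
    have hwin' : ((R.linRange (d4a r.o) (d4b r.o)).1 : ℝ) ≤ (ElemQ.run r).uOf z ∧
        (ElemQ.run r).uOf z ≤ ((R.linRange (d4a r.o) (d4b r.o)).2 : ℝ) := by
      rw [(uOf_vOf_run r z).1]; exact hwin
    -- frame coordinates
    obtain ⟨hux, hvx⟩ := uOf_vOf_dg s.d z
    obtain ⟨hux', hvx'⟩ := uOf_vOf_run r z
    set u := (ElemQ.dg s.d).uOf z with hudef
    set v := (ElemQ.dg s.d).vOf z with hvdef
    set X := (d4a s.d.o : ℝ) * z 0 + (d4b s.d.o : ℝ) * z 1 with hX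
    set Y := (d4c s.d.o : ℝ) * z 0 + (d4d s.d.o : ℝ) * z 1 with hY
    -- the line on the piece
    have hTf : s.Tf u = C + W * u := by
      rw [SDgQ.Tf, ← Pw.cval_static (t₀ := t₀) (τ := τ) (static_of_validB hv) t u]
      have hl := line_eq_of_lineData hv hL (α := endVal b) (u := u) (Pw.inGap_of_gapAtEndB hgap hu)
      simp only [ElemQ.line] at hl
      simp only [Pw.cval, ht, hl]
    rw [s.scalar_frame, ElemQ.scalar_frame, ht, ht', ← hudef, ← hvdef, hTf]
    simp only [ElemQ.line, ElemQ.xi, Aff.eval_endVal]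
    have hsh' : (s.sh : ℝ) = W / 2 := by
      have : ((2 * s.sh : ℚ) : ℝ) = W := by exact_mod_cast hsh
      push_cast at this; linarith
    rcases hcases with ⟨⟨⟨hW, hxr⟩, hyr⟩, hhalf⟩ | ⟨⟨⟨hW, hxr⟩, hyr⟩, hhalf⟩
    · -- W = 1: horizontal arm
      have hW' : (W : ℝ) = 1 := by exact_mod_cast hW
      obtain ⟨ea, eb⟩ := Prod.mk.inj hxr
      have hx' : (ElemQ.run r).uOf z = X := by rw [hux', hX, ea, eb]
      have hΞ := Pw.du_of_halfShiftOnB hhalf hwin'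
      rcases hyr with ⟨hyr, hyc⟩ | ⟨hyr, hyc⟩
      · obtain ⟨ec, ed⟩ := Prod.mk.inj hyr
        have hy' : (ElemQ.run r).vOf z = Y := by rw [hvx', hY, ec, ed]
        have hyc' : (r.y.atEnd b' : ℝ) = C / 2 := by rw [hyc]; push_cast; ring
        rw [hyc', hΞ, hx', hy', hux, hvx, hsh', hW']
        congr 1
        have e1 : X - Y + 1 / 2 * (X + Y - (C + 1 * (X - Y))) = X - ((C / 2 : ℚ) : ℝ) := by push_cast; ring
        rw [e1]
        push_cast
        field_simp
        ring
      · obtain ⟨ec, ed⟩ := Prod.mk.inj hyr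
        have hy' : (ElemQ.run r).vOf z = -Y := by rw [hvx', ec, ed, hY]; push_cast; ring
        have hyc' : (r.y.atEnd b' : ℝ) = -(C / 2) := by rw [hyc]; push_cast; ring
        rw [hyc', hΞ, hx', hy', hux, hvx, hsh', hW', ← hGe]
        congr 1
        have e1 : X - Y + 1 / 2 * (X + Y - (C + 1 * (X - Y))) = X - ((C / 2 : ℚ) : ℝ) := by push_cast; ring
        rw [e1]
        push_cast
        field_simp
        ring
    · -- W = -1: vertical arm
      have hW' : (W : ℝ) = -1 := by exact_mod_cast hW
      obtain ⟨ea, eb⟩ := Prod.mk.inj hxr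
      have hx' : (ElemQ.run r).uOf z = -Y := by rw [hux', ea, eb, hY]; push_cast; ring
      have hΞ := Pw.du_of_halfShiftOnB hhalf hwin'
      rcases hyr with ⟨hyr, hyc⟩ | ⟨hyr, hyc⟩
      · obtain ⟨ec, ed⟩ := Prod.mk.inj hyr
        have hy' : (ElemQ.run r).vOf z = X := by rw [hvx', hX, ec, ed]
        have hyc' : (r.y.atEnd b' : ℝ) = C / 2 := by rw [hyc]; push_cast; ring
        rw [hyc', hΞ, hx', hy', hux, hvx, hsh', hW']
        congr 1
        have e1 : X - Y + -1 / 2 * (X + Y - (C + -1 * (X - Y))) = -Y - ((-(C / 2) : ℚ) : ℝ) := by push_cast; ring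
        rw [e1]
        push_cast
        field_simp
        ring
      · obtain ⟨ec, ed⟩ := Prod.mk.inj hyr
        have hy' : (ElemQ.run r).vOf z = -X := by rw [hvx', ec, ed, hX]; push_cast; ring
        have hyc' : (r.y.atEnd b' : ℝ) = -(C / 2) := by rw [hyc]; push_cast; ring
        rw [hyc', hΞ, hx', hy', hux, hvx, hsh', hW', ← hGe]
        congr 1
        have e1 : X - Y + -1 / 2 * (X + Y - (C + -1 * (X - Y))) = -Y - ((-(C / 2) : ℚ) : ℝ) := by push_cast; ring
        rw [e1]
        push_cast
        field_simp
        ring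

variable {s : SDgQ}

/-- **Band-bounded gap test** of a sheared node at the end `b`: the abscissa interval `[ua, ub]` widened by
`M = |sh| · r₀ · whi` lies in the material gap `mΞ` (no line data: any line regime, arcs included). [folklore] -/
def shGapOKB (s : SDgQ) (b : Bool) (mΞ : ℕ) (ua ub r₀ : ℚ) : Bool :=
  -- the gap is read on the FROZEN profile (kinks of zero jump at the end are invisible there)
  ((ElemQ.dg s.d).frz b).validB &&
    (s.d.Ξ.frzPw b).gapAtEndB mΞ b (ua - |s.sh| * r₀ * s.d.whi) (ub + |s.sh| * r₀ * s.d.whi) && decide (0 ≤ r₀)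

/-- **Soundness of the band-bounded gap test**: where the transverse offset is within the band bound
`r₀ · whi`, the sheared scalar is the scalar of the data. [folklore] -/
theorem scalar_eq_d_of_shGapOKB (hv : s.validB = true) {b : Bool} {mΞ : ℕ} {ua ub r₀ : ℚ}
    (h : s.shGapOKB b mΞ ua ub r₀ = true) {t₀ τ t : ℝ} (ht : clock t₀ τ t = endVal b) {z : E²}
    (hu : (ua : ℝ) ≤ (ElemQ.dg s.d).uOf z ∧ (ElemQ.dg s.d).uOf z ≤ ub)
    (hoff : |(ElemQ.dg s.d).vOf z - s.Tf ((ElemQ.dg s.d).uOf z)| ≤ r₀ * s.d.whi) (G : ℝ → ℝ) :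
    s.scalar t₀ τ G t z = s.d.scalar t₀ τ G t z := by
  simp only [shGapOKB, Bool.and_eq_true, decide_eq_true_eq] at h
  obtain ⟨⟨hfv, hgap⟩, hr⟩ := h
  have hvd := validD_of_validB hv
  -- the frozen profile: same slope function at the end, its gaps ignore the kinks of zero jump
  have hFf : (s.d.Ξ.frzPw b).LenPos := by
    have hm : (s.d.Ξ.frzPw b).matValidB s.d.wlo s.d.whi = true := by
      have := DgQ.matValid_of_validB (d := ⟨s.d.o, s.d.T.frzPw b, s.d.Ξ.frzPw b, s.d.wlo, s.d.whi, Aff.const 0, Aff.const 0⟩)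
        (by simpa [ElemQ.frz, ElemQ.validB] using hfv)
      simpa using this
    exact Pw.lenPos_of_matValidB hm
  have hduF : ∀ x : ℝ, s.d.Ξ.du (endVal b) x = (s.d.Ξ.frzPw b).du (endVal b) x := fun x =>
    Pw.du_eq_of_sameSlopeB (s.d.Ξ.sameSlopeB_frzPw b b) x
  set μ : ℝ := ((|s.sh| * r₀ * s.d.whi : ℚ) : ℝ) with hμ
  set u := (ElemQ.dg s.d).uOf z with hudef
  set w := diagFrame ((d4Frame s.d.o).app z) with hw
  have hw0 : w 0 = u := by rw [hudef, ElemQ.uOf_dg]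
  have hw1 : w 1 = (ElemQ.dg s.d).vOf z := by rw [ElemQ.vOf_dg]
  have hgap' : ∀ u' ∈ Icc (u - μ) (u + μ), (s.d.Ξ.frzPw b).InGap mΞ (endVal b) u' := by
    intro u' hu'
    refine Pw.inGap_of_gapAtEndB hgap ⟨?_, ?_⟩
    · push_cast; rw [hμ] at hu'; push_cast at hu'; linarith [hu.1, hu'.1]
    · push_cast; rw [hμ] at hu'; push_cast at hu'; linarith [hu.2, hu'.2]
  have hμ0 : (0 : ℝ) ≤ μ := by
    rw [hμ]; push_cast
    have hwhi : (0 : ℝ) ≤ s.d.whi := by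
      have := Pw.cdu_pos (t₀ := t₀) (τ := τ) (DgQ.matValid_of_validB hvd) t u
      have hm := Pw.cdu_mem_Icc (t₀ := t₀) (τ := τ) (DgQ.matValid_of_validB hvd) t u
      linarith [hm.2]
    have hr' : (0 : ℝ) ≤ r₀ := by exact_mod_cast hr
    positivity
  have hu0 := hgap' u ⟨by linarith, by linarith⟩
  have hbound : |(s.sh : ℝ)| * |w 1 - s.Tf (w 0)| ≤ μ := by
    rw [hw0, hw1, hμ]; push_cast
    calc |(s.sh : ℝ)| * |(ElemQ.dg s.d).vOf z - s.Tf u| ≤ |(s.sh : ℝ)| * (r₀ * s.d.whi) :=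
          mul_le_mul_of_nonneg_left hoff (abs_nonneg _)
      _ = |(s.sh : ℝ)| * r₀ * s.d.whi := by ring
  have hW' : ∀ u' ∈ Icc (u - μ) (u + μ), s.d.Ξ.cdu t₀ τ t u' = s.d.Ξ.cdu t₀ τ t u := by
    intro u' hu'
    simp only [Pw.cdu, ht]
    rw [hduF, hduF, (s.d.Ξ.frzPw b).du_eq_W hFf (hgap' u' hu'), (s.d.Ξ.frzPw b).du_eq_W hFf hu0]
  refine scalar_eq_dScalar hv G ?_
  have := cdu_shAbscissa_eq (e := s) (t₀ := t₀) (τ := τ) (t := t) hw0 hW' hbound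
  rw [hw0] at this ⊢; exact this

/-- The transverse offset is within the band bound where the SHEARED scalar is nonzero. [folklore] -/
theorem abs_offset_le_of_scalar_ne_zero (hv : s.validB = true) {G : ℝ → ℝ} {r₀ : ℚ}
    (hG0 : ∀ q, G q ≠ 0 → |q| < r₀) {t₀ τ t : ℝ} {z : E²} (hne : s.scalar t₀ τ G t z ≠ 0) :
    |(ElemQ.dg s.d).vOf z - s.Tf ((ElemQ.dg s.d).uOf z)| ≤ r₀ * s.d.whi := by
  rw [s.scalar_frame] at hne
  set n := (ElemQ.dg s.d).vOf z - s.Tf ((ElemQ.dg s.d).uOf z)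
  set ξ := (ElemQ.dg s.d).uOf z + s.sh * n
  have hq := hG0 _ hne
  have hm := DgQ.matValid_of_validB (validD_of_validB hv)
  have hD : 0 < s.d.Ξ.cdu t₀ τ t ξ := Pw.cdu_pos (t₀ := t₀) (τ := τ) hm t ξ
  have hDw : s.d.Ξ.cdu t₀ τ t ξ ≤ s.d.whi := (Pw.cdu_mem_Icc (t₀ := t₀) (τ := τ) hm t ξ).2
  have hD' : 0 < s.d.Ξ.du (clock t₀ τ t) ξ := hD
  rw [abs_div, abs_of_pos hD', div_lt_iff₀ hD'] at hq
  have hr : (0 : ℝ) ≤ r₀ := by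
    have := abs_nonneg (n / s.d.Ξ.du (clock t₀ τ t) ξ)
    have h2 := hG0 _ hne
    linarith
  calc |n| ≤ r₀ * s.d.Ξ.du (clock t₀ τ t) ξ := hq.le
    _ ≤ r₀ * s.d.whi := mul_le_mul_of_nonneg_left hDw hr

/-- The transverse offset is within the band bound where the scalar of the DATA is nonzero. [folklore] -/
theorem abs_offset_le_of_dScalar_ne_zero (hv : s.validB = true) {G : ℝ → ℝ} {r₀ : ℚ}
    (hG0 : ∀ q, G q ≠ 0 → |q| < r₀) {t₀ τ t : ℝ} {z : E²} (hne : s.d.scalar t₀ τ G t z ≠ 0) :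
    |(ElemQ.dg s.d).vOf z - s.Tf ((ElemQ.dg s.d).uOf z)| ≤ r₀ * s.d.whi := by
  have hf := (ElemQ.dg s.d).scalar_frame t₀ τ G t z
  simp only [ElemQ.scalar] at hf
  rw [hf] at hne
  simp only [ElemQ.line, ElemQ.xi] at hne
  have hT : s.d.T.val (clock t₀ τ t) ((ElemQ.dg s.d).uOf z) = s.Tf ((ElemQ.dg s.d).uOf z) := by
    rw [SDgQ.Tf, ← Pw.cval_static (t₀ := t₀) (τ := τ) (static_of_validB hv) t]; rfl
  rw [hT] at hne
  set n := (ElemQ.dg s.d).vOf z - s.Tf ((ElemQ.dg s.d).uOf z)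
  set u := (ElemQ.dg s.d).uOf z
  have hq := hG0 _ hne
  have hm := DgQ.matValid_of_validB (validD_of_validB hv)
  have hD : 0 < s.d.Ξ.cdu t₀ τ t u := Pw.cdu_pos (t₀ := t₀) (τ := τ) hm t u
  have hDw : s.d.Ξ.cdu t₀ τ t u ≤ s.d.whi := (Pw.cdu_mem_Icc (t₀ := t₀) (τ := τ) hm t u).2
  have hD' : 0 < s.d.Ξ.du (clock t₀ τ t) u := hD
  rw [abs_div, abs_of_pos hD', div_lt_iff₀ hD'] at hq
  have hr : (0 : ℝ) ≤ r₀ := by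
    have := abs_nonneg (n / s.d.Ξ.du (clock t₀ τ t) u)
    have h2 := hG0 _ hne
    linarith
  calc |n| ≤ r₀ * s.d.Ξ.du (clock t₀ τ t) u := hq.le
    _ ≤ r₀ * s.d.whi := mul_le_mul_of_nonneg_left hDw hr

end SDgQ

/-! ## Certificates on pieces of second-layer elements -/

/-- **Equivalence certificates of the second layer.** [folklore] -/
inductive EquivCert2
  /-- two first-layer elements with a first-layer certificate -/
  | base (c : EquivCert)
  /-- a first-layer certificate between the MATERIAL views, with the piece tests of the sheared
  sides: gap pairs `(mT₁, mΞ₁)` of the covered element on the piece interval, `(mT₂, mΞ₂)` of the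
  covering element on `[ua', ub']` -/
  | viaDg (c : EquivCert) (mT₁ mΞ₁ mT₂ mΞ₂ : ℕ) (ua' ub' : ℚ)
  /-- run ↔ sheared band on its unsheared arm (`shRunMatchB`): line gap `mT` of the band; when the
  band is the COVERING element, its abscissa range `[ua', ub']` on the region -/
  | shLocalXi (mT : ℕ) (ua' ub' : ℚ)
  /-- a first-layer certificate between the material views with the BAND-BOUNDED gap tests of the
  sheared sides (`shGapOKB`: material gaps `mΞ₁` on the piece interval, `mΞ₂` on `[ua', ub']`, widened
  by `|sh| r₀ whi`; any line regime) -/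
  | viaDgB (c : EquivCert) (mΞ₁ mΞ₂ : ℕ) (ua' ub' : ℚ)
  /-- material views of the SAME SHAPE (same constructor, orientation, frozen line data) in frozen
  material gaps `mΞ₁` (piece) / `mΞ₂` (`[ua', ub']`) of EQUAL slope — any line regime (arcs after a
  width change of the pair interior) — with the band-bounded gap tests of the sheared sides -/
  | sameTGap (mΞ₁ mΞ₂ : ℕ) (ua' ub' : ℚ)
deriving DecidableEq, Inhabited

namespace ElemQ

/-- **Flipped shape**: diagonal bands with frame codes related by the flip and negated frozen line
data (the abscissa `u` is the same function, the ordinate changes sign); the material profiles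
unrestricted. [folklore] -/
def flipShapeB : ElemQ → Bool → ElemQ → Bool → Bool
  | dg d, e, dg d', e' => decide (d'.o = flipCode d.o) && d.T.negFrzB e d'.T e'
  | _, _, _, _ => false

/-- The abscissae of flip-shaped elements coincide. [folklore] -/
theorem uOf_eq_of_flipShapeB {e₁ e₂ : ElemQ} {b₁ b₂ : Bool} (h : flipShapeB e₁ b₁ e₂ b₂ = true) (z : E²) : e₁.uOf z = e₂.uOf z := by
  cases e₁ with
  | run r => simp [flipShapeB] at h
  | dg d => cases e₂ with
    | run _ => simp [flipShapeB] at h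
    | dg d' =>
      simp only [flipShapeB, Bool.and_eq_true, decide_eq_true_eq] at h
      rw [uOf_dg, uOf_dg, h.1, d4Frame_flipCode_app]
      simp [diagFrame, vec2_apply_zero, vec2_apply_one]; ring

/-- **Scalars of flip-shaped elements agree where the material slopes agree** (even profile). [folklore] -/
theorem scalar_eq_of_flipShapeB {e₁ e₂ : ElemQ} {b₁ b₂ : Bool} (h : flipShapeB e₁ b₁ e₂ b₂ = true) {G : ℝ → ℝ}
    (hGe : ∀ x, G (-x) = G x) {t₀ τ t₀' τ' t t' : ℝ} (ht : clock t₀ τ t = endVal b₁) (ht' : clock t₀' τ' t' = endVal b₂)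
    {z : E²} (hdu : e₁.xi.du (endVal b₁) (e₁.uOf z) = e₂.xi.du (endVal b₂) (e₂.uOf z)) :
    e₁.scalar t₀ τ G t z = e₂.scalar t₀' τ' G t' z := by
  have hu := uOf_eq_of_flipShapeB h z
  cases e₁ with
  | run r => simp [flipShapeB] at h
  | dg d =>
    cases e₂ with
    | run r' => simp [flipShapeB] at h
    | dg d' =>
      simp only [flipShapeB, Bool.and_eq_true, decide_eq_true_eq] at h
      obtain ⟨ho, hT⟩ := h
      simp only [xi] at hdu
      have hu1 : (dg d).uOf z = ((d4Frame d.o).app z) 0 - ((d4Frame d.o).app z) 1 := by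
        rw [uOf_dg]; simp [diagFrame, vec2_apply_zero]
      rw [hu] at hdu hu1
      simp only [ElemQ.scalar, DgQ.scalar, LinFrame.conjScalar_apply, cornerScalar_apply, Pw.cval, Pw.cdu, ht, ht', ho,
        d4Frame_flipCode_app, vec2_apply_zero, vec2_apply_one]
      rw [Pw.val_eq_neg_of_negFrzB hT]
      have e1 : -((d4Frame d.o).app z) 1 - -((d4Frame d.o).app z) 0 = ((d4Frame d.o).app z) 0 - ((d4Frame d.o).app z) 1 := by ring
      rw [e1, ← hu1, ← hdu, ← hGe]
      congr 1
      rw [← neg_div]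
      congr 1
      ring

/-- **Same or flipped shape, frozen material gaps of equal slope**: the test. [folklore] -/
def sameTGapB (e₁ : ElemQ) (b₁ : Bool) (mΞ₁ : ℕ) (ua ub : ℚ) (e₂ : ElemQ) (b₂ : Bool) (mΞ₂ : ℕ) (ua' ub' : ℚ) : Bool :=
  (sameShapeB e₁ b₁ e₂ b₂ || flipShapeB e₁ b₁ e₂ b₂) && (e₁.frz b₁).validB && (e₂.frz b₂).validB &&
    (e₁.frz b₁).xi.gapAtEndB mΞ₁ b₁ ua ub && (e₂.frz b₂).xi.gapAtEndB mΞ₂ b₂ ua' ub' &&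
    decide (((e₁.frz b₁).xi.WAff mΞ₁).atEnd b₁ = ((e₂.frz b₂).xi.WAff mΞ₂).atEnd b₂)

/-- The abscissae of same-shape elements coincide. [folklore] -/
theorem uOf_eq_of_sameShapeB {e₁ e₂ : ElemQ} {b₁ b₂ : Bool} (h : sameShapeB e₁ b₁ e₂ b₂ = true) (z : E²) : e₁.uOf z = e₂.uOf z := by
  cases e₁ with
  | run r => cases e₂ with
    | dg _ => simp [sameShapeB] at h
    | run r' => simp only [sameShapeB, Bool.and_eq_true, decide_eq_true_eq] at h; simp [uOf, uC, h.1]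
  | dg d => cases e₂ with
    | run _ => simp [sameShapeB] at h
    | dg d' => simp only [sameShapeB, Bool.and_eq_true, decide_eq_true_eq] at h; simp [uOf, uC, h.1]

/-- The frozen element has the same material slope function at the end. [folklore] -/
theorem xi_du_frz (e : ElemQ) (b : Bool) (u : ℝ) : (e.frz b).xi.du (endVal b) u = e.xi.du (endVal b) u := by
  cases e with
  | run r => exact (Pw.du_eq_of_sameSlopeB (r.Ξ.sameSlopeB_frzPw b b) u).symm
  | dg d => exact (Pw.du_eq_of_sameSlopeB (d.Ξ.sameSlopeB_frzPw b b) u).symm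

/-- **Soundness**: equal scalars at frozen instants on the piece. [folklore] -/
theorem scalar_eq_of_sameTGapB {e₁ e₂ : ElemQ} {b₁ b₂ : Bool} {mΞ₁ mΞ₂ : ℕ} {ua ub ua' ub' : ℚ}
    (h : sameTGapB e₁ b₁ mΞ₁ ua ub e₂ b₂ mΞ₂ ua' ub' = true) {G : ℝ → ℝ} (hGe : ∀ x, G (-x) = G x) {t₀ τ t₀' τ' t t' : ℝ}
    (ht : clock t₀ τ t = endVal b₁) (ht' : clock t₀' τ' t' = endVal b₂) {z : E²}
    (hu : (ua : ℝ) ≤ e₁.uOf z ∧ e₁.uOf z ≤ ub) (hu' : (ua' : ℝ) ≤ e₂.uOf z ∧ e₂.uOf z ≤ ub') :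
    e₁.scalar t₀ τ G t z = e₂.scalar t₀' τ' G t' z := by
  simp only [sameTGapB, Bool.and_eq_true, decide_eq_true_eq, Bool.or_eq_true] at h
  obtain ⟨⟨⟨⟨⟨hshape, hf₁⟩, hf₂⟩, hg₁⟩, hg₂⟩, hW⟩ := h
  have hF₁ : (e₁.frz b₁).xi.LenPos := Pw.lenPos_of_matValidB ((e₁.frz b₁).matValid_of_validB hf₁)
  have hF₂ : (e₂.frz b₂).xi.LenPos := Pw.lenPos_of_matValidB ((e₂.frz b₂).matValid_of_validB hf₂)
  have hdu : e₁.xi.du (endVal b₁) (e₁.uOf z) = e₂.xi.du (endVal b₂) (e₂.uOf z) := by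
    rw [← xi_du_frz e₁ b₁, ← xi_du_frz e₂ b₂, Pw.du_eq_W hF₁ (Pw.inGap_of_gapAtEndB hg₁ hu),
      Pw.du_eq_W hF₂ (Pw.inGap_of_gapAtEndB hg₂ hu'), ← Pw.eval_WAff, ← Pw.eval_WAff, Aff.eval_endVal, Aff.eval_endVal, hW]
  rcases hshape with hshape | hshape
  · exact scalar_eq_of_sameShapeB hshape G ht ht' hdu
  · exact scalar_eq_of_flipShapeB hshape hGe ht ht' hdu

end ElemQ

namespace ElemQ2

/-- The piece test of an element's sheared side (trivially true for a first-layer element). [folklore] -/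
def shPieceOK2B (e : ElemQ2) (b : Bool) (mT mΞ : ℕ) (ua ub : ℚ) (R : RectQ) : Bool :=
  match e with
  | base _ => true
  | sdg s => s.shPieceOKB b mT mΞ ua ub R

/-- The band-bounded gap test of an element's sheared side (trivially true for a first-layer element). [folklore] -/
def shGapOK2B (e : ElemQ2) (b : Bool) (mΞ : ℕ) (ua ub r₀ : ℚ) : Bool :=
  match e with
  | base _ => true
  | sdg s => s.shGapOKB b mΞ ua ub r₀

/-- **Certificate test on a piece** for second-layer elements (`r₀` = the profile radius of the
covered phase, used by the band-bounded tests). [folklore] -/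
def certOnPiece2B (e₁ : ElemQ2) (b₁ : Bool) (π : PieceQ) (T : RectQ.StripQ) (e₂ : ElemQ2) (b₂ : Bool) (R : RectQ) (r₀ : ℚ) :
    EquivCert2 → Bool
  | .base c =>
    match e₁, e₂ with
    | .base a, .base a' => ElemQ.certOnPieceB a b₁ π T a' b₂ R c
    | _, _ => false
  | .viaDg c mT₁ mΞ₁ mT₂ mΞ₂ ua' ub' =>
    ElemQ.certOnPieceB e₁.toElemQ b₁ π T e₂.toElemQ b₂ R c &&
      e₁.shPieceOK2B b₁ mT₁ mΞ₁ (π.ua.atEnd b₁) (π.ub.atEnd b₁) R &&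
      e₂.shPieceOK2B b₂ mT₂ mΞ₂ ua' ub' R && ElemQ.uRangeOnPieceB e₁.toElemQ π b₁ e₂.toElemQ R T ua' ub'
  | .shLocalXi mT ua' ub' =>
    match e₁, e₂ with
    | .sdg s, .base (.run r) => s.shRunMatchB b₁ mT (π.ua.atEnd b₁) (π.ub.atEnd b₁) r b₂ R
    | .base (.run r), .sdg s =>
      s.shRunMatchB b₂ mT ua' ub' r b₁ R && ElemQ.uRangeOnPieceB (ElemQ.run r) π b₁ (ElemQ.dg s.d) R T ua' ub'
    | _, _ => false
  | .viaDgB c mΞ₁ mΞ₂ ua' ub' =>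
    ElemQ.certOnPieceB e₁.toElemQ b₁ π T e₂.toElemQ b₂ R c &&
      e₁.shGapOK2B b₁ mΞ₁ (π.ua.atEnd b₁) (π.ub.atEnd b₁) r₀ &&
      e₂.shGapOK2B b₂ mΞ₂ ua' ub' r₀ && ElemQ.uRangeOnPieceB e₁.toElemQ π b₁ e₂.toElemQ R T ua' ub'
  | .sameTGap mΞ₁ mΞ₂ ua' ub' =>
    ElemQ.sameTGapB e₁.toElemQ b₁ mΞ₁ (π.ua.atEnd b₁) (π.ub.atEnd b₁) e₂.toElemQ b₂ mΞ₂ ua' ub' &&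
      e₁.shGapOK2B b₁ mΞ₁ (π.ua.atEnd b₁) (π.ub.atEnd b₁) r₀ &&
      e₂.shGapOK2B b₂ mΞ₂ ua' ub' r₀ && ElemQ.uRangeOnPieceB e₁.toElemQ π b₁ e₂.toElemQ R T ua' ub'

/-- The second-layer scalar is the scalar of the material view where the piece test of the sheared
side holds (first-layer elements: always). [folklore] -/
theorem scalar_eq_toElemQ_of_shPieceOK2B {e : ElemQ2} (hv : e.validB = true) {b : Bool} {mT mΞ : ℕ} {ua ub : ℚ} {R : RectQ}
    (h : e.shPieceOK2B b mT mΞ ua ub R = true) {t₀ τ t : ℝ} (ht : clock t₀ τ t = endVal b) {z : E²} (hz : R.mem z)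
    (hu : (ua : ℝ) ≤ e.toElemQ.uOf z ∧ e.toElemQ.uOf z ≤ ub) (G : ℝ → ℝ) :
    e.scalar t₀ τ G t z = e.toElemQ.scalar t₀ τ G t z := by
  cases e with
  | base a => rfl
  | sdg s => exact SDgQ.scalar_eq_d_of_shPieceOKB hv h ht hz hu G

/-- **Soundness of a certificate on a piece** (second layer), at a point where the covered scalar is
nonzero (the only use, `scalar_eq_of_coverEntry2`; the band-bounded tests need it). [folklore] -/
theorem scalar_eq_of_certOnPiece2B {e₁ e₂ : ElemQ2} (hv₁ : e₁.validB = true) (hv₂ : e₂.validB = true) {b₁ b₂ : Bool}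
    {π : PieceQ} {T : RectQ.StripQ} {R : RectQ} {r₀ : ℚ} {c : EquivCert2} (h : certOnPiece2B e₁ b₁ π T e₂ b₂ R r₀ c = true)
    {G : ℝ → ℝ} (hGe : ∀ x, G (-x) = G x) (hG0 : ∀ q, G q ≠ 0 → |q| < r₀) {t₀ τ t₀' τ' t t' : ℝ} (ht : clock t₀ τ t = endVal b₁)
    (ht' : clock t₀' τ' t' = endVal b₂) {z : E²} (hz : R.mem z) (hT : T.mem z)
    (hu : e₁.toElemQ.uOf z ∈ Icc (π.ua.eval (endVal b₁)) (π.ub.eval (endVal b₁))) (hne : e₁.scalar t₀ τ G t z ≠ 0) :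
    e₁.scalar t₀ τ G t z = e₂.scalar t₀' τ' G t' z := by
  cases c with
  | viaDgB c mΞ₁ mΞ₂ ua' ub' =>
    simp only [certOnPiece2B, Bool.and_eq_true] at h
    obtain ⟨⟨⟨hc, h1⟩, h2⟩, hrange⟩ := h
    have hu' : (π.ua.atEnd b₁ : ℝ) ≤ e₁.toElemQ.uOf z ∧ e₁.toElemQ.uOf z ≤ π.ub.atEnd b₁ := by
      simpa only [Aff.eval_endVal] using (show π.ua.eval (endVal b₁) ≤ e₁.toElemQ.uOf z ∧ e₁.toElemQ.uOf z ≤ π.ub.eval (endVal b₁) from hu)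
    have hu₂ := ElemQ.uOf_mem_of_uRangeOnPieceB hrange hz hT hu'
    -- the covered side
    have he₁ : e₁.scalar t₀ τ G t z = e₁.toElemQ.scalar t₀ τ G t z := by
      cases e₁ with
      | base a => rfl
      | sdg s₁ =>
        exact SDgQ.scalar_eq_d_of_shGapOKB hv₁ h1 ht hu' (SDgQ.abs_offset_le_of_scalar_ne_zero hv₁ hG0 hne) G
    have hmid : e₁.toElemQ.scalar t₀ τ G t z = e₂.toElemQ.scalar t₀' τ' G t' z :=
      ElemQ.scalar_eq_of_certOnPieceB hc hGe ht ht' hz hT hu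
    have hne₂ : e₂.toElemQ.scalar t₀' τ' G t' z ≠ 0 := by rw [← hmid, ← he₁]; exact hne
    have he₂ : e₂.scalar t₀' τ' G t' z = e₂.toElemQ.scalar t₀' τ' G t' z := by
      cases e₂ with
      | base a => rfl
      | sdg s₂ => exact SDgQ.scalar_eq_d_of_shGapOKB hv₂ h2 ht' hu₂ (SDgQ.abs_offset_le_of_dScalar_ne_zero hv₂ hG0 hne₂) G
    rw [he₁, hmid, he₂]
  | sameTGap mΞ₁ mΞ₂ ua' ub' =>
    simp only [certOnPiece2B, Bool.and_eq_true] at h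
    obtain ⟨⟨⟨hc, h1⟩, h2⟩, hrange⟩ := h
    have hu' : (π.ua.atEnd b₁ : ℝ) ≤ e₁.toElemQ.uOf z ∧ e₁.toElemQ.uOf z ≤ π.ub.atEnd b₁ := by
      simpa only [Aff.eval_endVal] using (show π.ua.eval (endVal b₁) ≤ e₁.toElemQ.uOf z ∧ e₁.toElemQ.uOf z ≤ π.ub.eval (endVal b₁) from hu)
    have hu₂ := ElemQ.uOf_mem_of_uRangeOnPieceB hrange hz hT hu'
    have he₁ : e₁.scalar t₀ τ G t z = e₁.toElemQ.scalar t₀ τ G t z := by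
      cases e₁ with
      | base a => rfl
      | sdg s₁ =>
        exact SDgQ.scalar_eq_d_of_shGapOKB hv₁ h1 ht hu' (SDgQ.abs_offset_le_of_scalar_ne_zero hv₁ hG0 hne) G
    have hmid : e₁.toElemQ.scalar t₀ τ G t z = e₂.toElemQ.scalar t₀' τ' G t' z :=
      ElemQ.scalar_eq_of_sameTGapB hc hGe ht ht' hu' hu₂
    have hne₂ : e₂.toElemQ.scalar t₀' τ' G t' z ≠ 0 := by rw [← hmid, ← he₁]; exact hne
    have he₂ : e₂.scalar t₀' τ' G t' z = e₂.toElemQ.scalar t₀' τ' G t' z := by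
      cases e₂ with
      | base a => rfl
      | sdg s₂ => exact SDgQ.scalar_eq_d_of_shGapOKB hv₂ h2 ht' hu₂ (SDgQ.abs_offset_le_of_dScalar_ne_zero hv₂ hG0 hne₂) G
    rw [he₁, hmid, he₂]
  | base c =>
    cases e₁ with
    | sdg _ => cases e₂ <;> simp [certOnPiece2B] at h
    | base a =>
      cases e₂ with
      | sdg _ => simp [certOnPiece2B] at h
      | base a' =>
        simp only [certOnPiece2B] at h
        exact ElemQ.scalar_eq_of_certOnPieceB h hGe ht ht' hz hT hu
  | viaDg c mT₁ mΞ₁ mT₂ mΞ₂ ua' ub' =>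
    simp only [certOnPiece2B, Bool.and_eq_true] at h
    obtain ⟨⟨⟨hc, h1⟩, h2⟩, hrange⟩ := h
    have hu' : (π.ua.atEnd b₁ : ℝ) ≤ e₁.toElemQ.uOf z ∧ e₁.toElemQ.uOf z ≤ π.ub.atEnd b₁ := by
      simpa only [Aff.eval_endVal] using (show π.ua.eval (endVal b₁) ≤ e₁.toElemQ.uOf z ∧ e₁.toElemQ.uOf z ≤ π.ub.eval (endVal b₁) from hu)
    have hu₂ := ElemQ.uOf_mem_of_uRangeOnPieceB hrange hz hT hu'
    rw [scalar_eq_toElemQ_of_shPieceOK2B hv₁ h1 ht hz hu' G, scalar_eq_toElemQ_of_shPieceOK2B hv₂ h2 ht' hz hu₂ G]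
    exact ElemQ.scalar_eq_of_certOnPieceB hc hGe ht ht' hz hT hu
  | shLocalXi mT ua' ub' =>
    have hu' : (π.ua.atEnd b₁ : ℝ) ≤ e₁.toElemQ.uOf z ∧ e₁.toElemQ.uOf z ≤ π.ub.atEnd b₁ := by
      simpa only [Aff.eval_endVal] using (show π.ua.eval (endVal b₁) ≤ e₁.toElemQ.uOf z ∧ e₁.toElemQ.uOf z ≤ π.ub.eval (endVal b₁) from hu)
    cases e₁ with
    | sdg s₁ =>
      cases e₂ with
      | sdg _ => simp [certOnPiece2B] at h
      | base b₂' =>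
        cases b₂' with
        | dg _ => simp [certOnPiece2B] at h
        | run r =>
          simp only [certOnPiece2B] at h
          exact SDgQ.scalar_eq_run_of_shRunMatchB hv₁ h hGe ht ht' hz hu'
    | base b₁' =>
      cases b₁' with
      | dg _ => cases e₂ with | sdg _ => simp [certOnPiece2B] at h | base _ => simp [certOnPiece2B] at h
      | run r =>
        cases e₂ with
        | base _ => simp [certOnPiece2B] at h
        | sdg s₂ =>
          simp only [certOnPiece2B, Bool.and_eq_true] at h
          obtain ⟨hm, hrange⟩ := h
          have hu₂ := ElemQ.uOf_mem_of_uRangeOnPieceB hrange hz hT hu'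
          exact (SDgQ.scalar_eq_run_of_shRunMatchB hv₂ hm hGe ht' ht hz hu₂).symm

end ElemQ2

/-! ## Streams vanish at flat clock times (second layer) -/

namespace ElemQ2

/-- **At a time where the clock rate vanishes, the stream function of a second-layer element is `0`.**
[folklore] -/
theorem stream_eq_zero_of_clockDeriv (e : ElemQ2) {t₀ τ t : ℝ} (h : clockDeriv t₀ τ t = 0) (z : E²) :
    e.stream t₀ τ t z = 0 := by
  cases e with
  | base b => exact ElemQ.stream_eq_zero_of_clockDeriv b h z
  | sdg s =>
    simp [ElemQ2.stream, SDgQ.stream, LinFrame.conjStream_apply, shCornerStream, shGraphStream, DgQ.g, axialRate, Pw.cdt,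
      streamOffset, h]

end ElemQ2

/-! ## The re-description certificate and theorem, second layer -/

namespace PhaseQ2

variable (P : PhaseQ2)

/-- **At a flat clock time the assembled stream function is `0`.** [folklore] -/
theorem stream_eq_zero_of_clockDeriv (P : PhaseQ2) {t : ℝ} (h : clockDeriv P.T0 P.Tau t = 0) (z : E²) : P.stream t z = 0 := by
  rw [PhaseQ2.stream, assembledStream_apply]
  simp [PhaseQ2.H, ElemQ2.stream_eq_zero_of_clockDeriv _ h]

/-- **At a flat clock time the assembled velocity is `0`.** [folklore] -/
theorem velocity_eq_zero_of_clockDeriv (P : PhaseQ2) {t : ℝ} (h : clockDeriv P.T0 P.Tau t = 0) (z : E²) : P.velocity t z = 0 := by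
  have hfun : P.stream t = fun _ => 0 := funext fun w => P.stream_eq_zero_of_clockDeriv h w
  have hv : P.velocity t z = perpGrad (P.stream t) z := rfl
  rw [hv, hfun, perpGrad_apply]
  simp [vec2]

/-- **Velocities of two phases agree at flat clock times** (both vanish). [folklore] -/
theorem velocity_eq_of_clockDeriv (P P' : PhaseQ2) {t : ℝ} (h : clockDeriv P.T0 P.Tau t = 0) (h' : clockDeriv P'.T0 P'.Tau t = 0) :
    P.velocity t = P'.velocity t :=
  funext fun z => by rw [P.velocity_eq_zero_of_clockDeriv h, P'.velocity_eq_zero_of_clockDeriv h']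

/-- **Junction agreement of the scalars** (second layer, agreement regions `Agree2`). [folklore] -/
def JAgree2 (P : PhaseQ2) (G : ℝ → ℝ) : Prop :=
  ∀ k, k + 1 < P.K → ∀ p ∈ P.chain.juncCut k ∩ P.Agree2 k, P.Θ G (k + 1) p.1 p.2 = P.Θ G k p.1 p.2

variable {P}

/-- A sum over `range K` with all terms but two (distinct) ones zero. [folklore] -/
private theorem sum_range_eq_pair2 {K a b : ℕ} (hab : a ≠ b) (ha : a < K) (hb : b < K) (f : ℕ → ℝ)
    (h0 : ∀ j < K, j ≠ a → j ≠ b → f j = 0) : ∑ j ∈ Finset.range K, f j = f a + f b := by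
  rw [← Finset.sum_subset (s₁ := {a, b}) (by
      intro j hj; simp only [Finset.mem_insert, Finset.mem_singleton] at hj
      rcases hj with rfl | rfl <;> simpa)
    (by
      intro j hj hjn
      simp only [Finset.mem_insert, Finset.mem_singleton, not_or] at hjn
      exact h0 j (Finset.mem_range.1 hj) hjn.1 hjn.2)]
  rw [Finset.sum_pair hab]

/-- **On a cut junction with agreement the assembled scalar is the element scalar.** [folklore] -/
theorem scalar_eq_of_juncCut2 {G : ℝ → ℝ} (hW : P.chain.WFBd P.Band) (hA : P.JAgree2 G) {k : ℕ} (hk : k + 1 < P.K)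
    {t : ℝ} {z : E²} (hp : (t, z) ∈ P.chain.juncCut k ∩ P.Agree2 k) :
    P.scalar G t z = P.Θ G k t z ∧ P.scalar G t z = P.Θ G (k + 1) t z := by
  have hkc : k + 1 < P.chain.K := by simpa using hk
  have hj := hW.chi_junction hkc hp.1
  have hagree := hA k hk (t, z) hp
  have hsum : P.scalar G t z = P.chain.chi k t z * P.Θ G k t z + P.chain.chi (k + 1) t z * P.Θ G (k + 1) t z := by
    rw [PhaseQ2.scalar, assembledScalar_apply]
    exact sum_range_eq_pair2 (by omega) (by omega) hkc _ fun j hjK h1 h2 => by rw [hj.2 j hjK h1 h2, zero_mul]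
  simp only at hagree
  constructor
  · rw [hsum, hagree, ← add_mul, hj.1, one_mul]
  · rw [hsum, hagree, ← add_mul, hj.1, one_mul]

/-- **Pointwise evaluation on the closed square.** [folklore] -/
theorem scalar_eq_elem2 {G : ℝ → ℝ} (hg : P.geoPhase.geomB = true) (hsep : P.geoPhase.boxSepB = true) (hA : P.JAgree2 G)
    {k : ℕ} (hk : k < P.K) {t : ℝ} {z : E²} (hQ : ∀ j, 0 ≤ z j ∧ z j ≤ 1)
    (hp : (t, z) ∈ P.chain.tubeBox k ∩ P.Band k) : P.scalar G t z = P.Θ G k t z := by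
  have hW : P.chain.WFBd P.Band := PhaseQ.wfbd_of_geomB hg hsep
  have hkc : k < P.chain.K := by simpa using hk
  rcases cover2_of_geomB hg t hQ hkc hp with hc | ⟨hk0, hj⟩ | ⟨hk1, hj⟩
  · exact (hW.move_eq_of_core (Θ := P.Θ G) (H₀ := 0) (H := P.H) hkc hc).1
  · obtain ⟨k', rfl⟩ : ∃ k', k = k' + 1 := ⟨k - 1, by omega⟩
    simp only [Nat.add_sub_cancel] at hj
    exact (scalar_eq_of_juncCut2 hW hA (by omega) hj).2
  · exact (scalar_eq_of_juncCut2 hW hA (by simpa using hk1) hj).1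

/-- **Off every tube-box-and-band the assembled scalar vanishes.** [folklore] -/
theorem scalar_eq_zero_off2 {G : ℝ → ℝ} {M : ℝ} (hG : ContDiff ℝ ∞ G) (hM : ∀ q, |G q| ≤ M) (hM0 : 0 ≤ M)
    (hG0 : ∀ q, G q ≠ 0 → |q| < P.r₀) (hv : P.elemsValidB = true) (hg : P.geoPhase.geomB = true)
    (hsep : P.geoPhase.boxSepB = true) {t : ℝ} {z : E²} (hz : ∀ k < P.K, (t, z) ∉ P.chain.tubeBox k ∩ P.Band k) :
    P.scalar G t z = 0 :=
  (PhaseQ.wfbd_of_geomB hg hsep).scalar_eq_zero_off_tubes (P.facts hG hM hM0 hG0 hv) fun k hk => hz k (by simpa using hk)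

variable (P)

/-- **Tube rectangle** of node `k` at an end (that of the proxy: same boxes and steps). [folklore] -/
def tubeRect (P : PhaseQ2) (k : ℕ) (e : Bool) : RectQ := P.geoPhase.tubeRect k e

variable {P}

/-- **The tube rectangle is the tube box at an end.** [folklore] -/
theorem mem_tubeRect_iff2 (hpos : P.geoPhase.allPosB = true) (hs : P.geoPhase.sgnsOKB = true) {k : ℕ} (hk : k < P.K) {e : Bool}
    {t : ℝ} (ht : clock P.T0 P.Tau t = endVal e) (z : E²) : (P.tubeRect k e).mem z ↔ (t, z) ∈ P.chain.tubeBox k :=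
  PhaseQ.mem_tubeRect_iff hpos hs (by simpa using hk) ht z

variable (P)

/-- Candidate rectangles sorted by their lower coordinate along axis `i`. [folklore] -/
def _root_.Literature.Analysis.FluidPDE.PlanarKinematics.RectQ.sortLo (i : Fin 2) (L : List RectQ) : List RectQ :=
  L.mergeSort fun a b => decide (a.lo i ≤ b.lo i)

/-- Membership in the sorted list. [folklore] -/
theorem _root_.Literature.Analysis.FluidPDE.PlanarKinematics.RectQ.mem_sortLo {i : Fin 2} {L : List RectQ} {S : RectQ}
    (h : S ∈ RectQ.sortLo i L) : S ∈ L := List.mem_mergeSort.1 h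

/-- **Chain cover along either axis** (each with the candidates sorted along it): an L-shaped node
(leg and connector of a scope pair) needs different axes for different pieces. [folklore] -/
def _root_.Literature.Analysis.FluidPDE.PlanarKinematics.RectQ.chainCoversAnyB (R : RectQ) (T U : RectQ.StripQ) (L : List RectQ) : Bool :=
  R.chainCovers2B T U 0 (RectQ.sortLo 0 L) || R.chainCovers2B T U 1 (RectQ.sortLo 1 L)

/-- Soundness: a point of the region lies in a listed rectangle. [folklore] -/
theorem _root_.Literature.Analysis.FluidPDE.PlanarKinematics.RectQ.exists_mem_of_chainCoversAnyB {R : RectQ} {T U : RectQ.StripQ}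
    {L : List RectQ} (h : R.chainCoversAnyB T U L = true) {z : E²} (hz : R.mem z) (hT : T.mem z) (hU : U.mem z) :
    ∃ S ∈ L, S.mem z := by
  simp only [RectQ.chainCoversAnyB, Bool.or_eq_true] at h
  rcases h with h | h
  · obtain ⟨S, hS, hzS⟩ := RectQ.exists_mem_of_chainCovers2B h hz hT hU
    exact ⟨S, RectQ.mem_sortLo hS, hzS⟩
  · obtain ⟨S, hS, hzS⟩ := RectQ.exists_mem_of_chainCovers2B h hz hT hU
    exact ⟨S, RectQ.mem_sortLo hS, hzS⟩

/-- **Cover entry check** (second layer): pieces and strips of the proxies, certificates of the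
second layer; the chain cover of each piece along either axis. [folklore] -/
def coverEntry2B (P : PhaseQ2) (e : Bool) (P' : PhaseQ2) (e' : Bool) (k : ℕ) (entry : Fin 2 × List (ℕ × EquivCert2)) : Bool :=
  let R := P.tubeRect k e
  (entry.2.all fun kc => decide (kc.1 < P'.K)) &&
    (P.node k).ann.pieces.all fun π =>
      match (P.node k).e.geo.pieceStripO π P.r₀ e with
      | none => false
      | some T =>
        let good := entry.2.filter fun kc =>
          ElemQ2.certOnPiece2B (P.node k).e e π T (P'.node kc.1).e e' (R.inter (P'.tubeRect kc.1 e')) P.r₀ kc.2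
        R.chainCoversAnyB T ((P.node k).e.geo.pieceUStrip π e) (good.map fun kc => P'.tubeRect kc.1 e')

/-- **Frozen equality of the end nodes**: first-layer end elements (gate stubs), frozen-equal boxes
and steps, equivalent elements. [folklore] -/
def endNodesEq2B (P : PhaseQ2) (e : Bool) (P' : PhaseQ2) (e' : Bool) : Bool :=
  decide (2 ≤ P.K) && decide (2 ≤ P'.K) &&
    !(P.node 0).e.isSheared && !(P'.node 0).e.isSheared &&
    !(P.node (P.K - 1)).e.isSheared && !(P'.node (P'.K - 1)).e.isSheared &&
    (P.node 0).box.frzEqB e (P'.node 0).box e' && ElemQ.equivB (P.node 0).e.toElemQ e (P'.node 0).e.toElemQ e' &&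
    (P.node 0).step.frzEqB e (P'.node 0).step e' &&
    (P.node (P.K - 1)).box.frzEqB e (P'.node (P'.K - 1)).box e' &&
    ElemQ.equivB (P.node (P.K - 1)).e.toElemQ e (P'.node (P'.K - 1)).e.toElemQ e' &&
    (P.node (P.K - 2)).step.frzEqB e (P'.node (P'.K - 2)).step e'

/-- **Re-description certificate** (second layer). [folklore] -/
def redescribeB2 (P : PhaseQ2) (e : Bool) (P' : PhaseQ2) (e' : Bool) (cert : List (Fin 2 × List (ℕ × EquivCert2)))
    (cert' : List (Fin 2 × List (ℕ × EquivCert2))) : Bool :=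
  P.geoPhase.sgnsOKB && P'.geoPhase.sgnsOKB && P.geoPhase.middleInSqB e && P'.geoPhase.middleInSqB e' && endNodesEq2B P e P' e' &&
    decide (cert.length = P.K) && decide (cert'.length = P'.K) &&
    (List.range P.K).all (fun k => coverEntry2B P e P' e' k (cert.getD k (0, []))) &&
    (List.range P'.K).all (fun k' => coverEntry2B P' e' P e k' (cert'.getD k' (0, [])))

variable {P}

/-- The scalar of a non-sheared element is the scalar of its material view. [folklore] -/
theorem _root_.Literature.Analysis.FluidPDE.PlanarKinematics.ElemQ2.scalar_eq_toElemQ_of_not_isSheared {e : ElemQ2}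
    (h : e.isSheared = false) (t₀ τ : ℝ) (G : ℝ → ℝ) : e.scalar t₀ τ G = e.toElemQ.scalar t₀ τ G := by
  cases e with
  | base b => rfl
  | sdg s => simp [ElemQ2.isSheared] at h

/-- **One direction of the cover** (second layer). [folklore] -/
theorem scalar_eq_of_coverEntry2 {G : ℝ → ℝ} {M : ℝ} {P' : PhaseQ2} (hGP : PhaseQ.ProfileHyp G M P.r₀) (hGP' : PhaseQ.ProfileHyp G M P'.r₀)
    (hv : P.elemsValidB = true) (hg : P.geoPhase.geomB = true) (hsep : P.geoPhase.boxSepB = true) (hA : P.JAgree2 G)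
    (hv' : P'.elemsValidB = true) (hg' : P'.geoPhase.geomB = true) (hsep' : P'.geoPhase.boxSepB = true) (hA' : P'.JAgree2 G)
    (hs : P.geoPhase.sgnsOKB = true) (hs' : P'.geoPhase.sgnsOKB = true)
    {e e' : Bool} {k : ℕ} (hk : k < P.K) {entry : Fin 2 × List (ℕ × EquivCert2)} (hc : coverEntry2B P e P' e' k entry = true)
    {t t' : ℝ} (ht : clock P.T0 P.Tau t = endVal e) (ht' : clock P'.T0 P'.Tau t' = endVal e')
    {z : E²} (hQ : ∀ j, 0 ≤ z j ∧ z j ≤ 1) (hp : (t, z) ∈ P.chain.tubeBox k ∩ P.Band k) (hne : P.Θ G k t z ≠ 0) :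
    P'.scalar G t' z = P.scalar G t z := by
  have hkg : k < P.geoPhase.K := by simpa using hk
  have hpos : P.geoPhase.allPosB = true := (PhaseQ.geomB_at hg hkg).2.1
  simp only [coverEntry2B, Bool.and_eq_true, List.all_eq_true, decide_eq_true_eq] at hc
  obtain ⟨hall, hcov⟩ := hc
  have hzR : (P.tubeRect k e).mem z := (mem_tubeRect_iff2 hpos hs hk ht z).2 hp.1
  have hvk := validB_node hv hk
  have hvkg : (P.node k).e.geo.validB = true := ElemQ2.validB_geo hvk
  -- the point lies in an annotated piece of `k` (pieces of the proxy)
  have hpcs : P.geoPhase.piecesB k = true := (PhaseQ.geomB_at hg hkg).2.2.2.2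
  simp only [PhaseQ.piecesB, Bool.and_eq_true, geoPhase_node, NodeQ2.geo_e, NodeQ2.geo_ann, NodeQ2.geo_box, geoPhase_r₀] at hpcs
  have hOK := hpcs.1
  have hzsupp : z ∈ ((P.node k).box.frzAt (clock P.T0 P.Tau t)).supp := by
    have h1 : (t, z) ∈ {p : ℝ × E² | p.2 ∈ ((P.chain.frozen (t, z).1).B k).supp} := hp.1.1.1
    have eB : ((P.chain.box k).frz t) = (P.node k).box.frzAt (clock P.T0 P.Tau t) := by
      show ((P.geoPhase.chain.box k).frz t) = _
      rw [PhaseQ.chain_box, BoxQ.moving_frz, geoPhase_node]; rfl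
    have h2 : z ∈ ((P.chain.box k).frz t).supp := by simpa using h1
    rw [eB] at h2; exact h2
  have hband : (t, z) ∈ (P.node k).e.geo.bandT P.T0 P.Tau P.r₀ := by
    have h2 := hp.2
    simp only [PhaseQ2.Band, PhaseQ.Band, geoPhase_node, NodeQ2.geo_e, geoPhase_T0, geoPhase_Tau, geoPhase_r₀] at h2
    exact h2
  obtain ⟨π, hπ, hu, hreg⟩ := (P.node k).e.geo.exists_piece hvkg hOK hband hzsupp
  have hcovπ := hcov π hπ
  -- a listed node with a certificate valid on the piece whose tube rectangle contains the point
  obtain ⟨kc, hk'mem, hcert, hzS⟩ : ∃ kc ∈ entry.2,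
      ElemQ2.certOnPiece2B (P.node k).e e π
        (((P.node k).e.geo.pieceStripO π P.r₀ e).getD RectQ.StripQ.univ) (P'.node kc.1).e e'
        ((P.tubeRect k e).inter (P'.tubeRect kc.1 e')) P.r₀ kc.2 = true ∧ (P'.tubeRect kc.1 e').mem z := by
    revert hcovπ
    cases hT : (P.node k).e.geo.pieceStripO π P.r₀ e with
    | none => intro h; exact absurd h (by simp)
    | some T =>
      intro h
      have hr0 := (P.node k).e.geo.r0_nonneg_of_piecesOKB hOK
      obtain ⟨hT1, hT2⟩ := ElemQ.mem_pieceStrips hvkg hr0 ht hband hreg hu hT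
      obtain ⟨S, hS, hzS⟩ := RectQ.exists_mem_of_chainCoversAnyB h hzR hT1 hT2
      obtain ⟨kc, hkc, rfl⟩ := List.mem_map.1 hS
      obtain ⟨hmem, hgood⟩ := List.mem_filter.1 hkc
      exact ⟨kc, hmem, by simpa using hgood, hzS⟩
  have hk' : kc.1 < P'.K := hall kc hk'mem
  set k' := kc.1 with hk'def
  have hkg' : k' < P'.geoPhase.K := by simpa using hk'
  have hpos' : P'.geoPhase.allPosB = true := (PhaseQ.geomB_at hg' hkg').2.1
  have htube' : (t', z) ∈ P'.chain.tubeBox k' := (mem_tubeRect_iff2 hpos' hs' hk' ht' z).1 hzS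
  -- the element scalars agree at the point
  have huE : (P.node k).e.toElemQ.uOf z ∈ Icc (π.ua.eval (endVal e)) (π.ub.eval (endVal e)) := by
    rw [← ht]
    have eU : (P.node k).e.toElemQ.uOf z = (P.node k).e.geo.uOf z := by simp only [ElemQ.uOf, ElemQ2.uC_geo]
    rw [eU]; exact hu
  have hTmem : (((P.node k).e.geo.pieceStripO π P.r₀ e).getD RectQ.StripQ.univ).mem z := by
    cases hT : (P.node k).e.geo.pieceStripO π P.r₀ e with
    | none => simpa using RectQ.StripQ.mem_univ z
    | some T =>
      have hr0 := (P.node k).e.geo.r0_nonneg_of_piecesOKB hOK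
      simpa using (ElemQ.mem_pieceStrips hvkg hr0 ht hband hreg hu hT).1
  have helem : P.Θ G k t z = P'.Θ G k' t' z :=
    ElemQ2.scalar_eq_of_certOnPiece2B hvk (validB_node hv' hk') hcert hGP'.even hGP.supp ht ht' (RectQ.mem_inter hzR hzS) hTmem
      huE hne
  have hband' : (t', z) ∈ P'.Band k' :=
    (P'.facts hGP'.smooth hGP'.bound hGP'.nonneg hGP'.supp hv').band k' (by simpa using hk') (t', z) (by rw [← helem]; exact hne)
  rw [scalar_eq_elem2 hg hsep hA hk hQ hp, scalar_eq_elem2 hg' hsep' hA' hk' hQ ⟨htube', hband'⟩, helem]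

/-- **Equality on the closed square** from the two cover directions (second layer). [folklore] -/
theorem scalar_eq_of_covers_sq2 {G : ℝ → ℝ} {M : ℝ} {P' : PhaseQ2} (hGP : PhaseQ.ProfileHyp G M P.r₀) (hGP' : PhaseQ.ProfileHyp G M P'.r₀)
    (hv : P.elemsValidB = true) (hg : P.geoPhase.geomB = true) (hsep : P.geoPhase.boxSepB = true) (hA : P.JAgree2 G)
    (hv' : P'.elemsValidB = true) (hg' : P'.geoPhase.geomB = true) (hsep' : P'.geoPhase.boxSepB = true) (hA' : P'.JAgree2 G)
    (hs : P.geoPhase.sgnsOKB = true) (hs' : P'.geoPhase.sgnsOKB = true)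
    {e e' : Bool} {cert cert' : List (Fin 2 × List (ℕ × EquivCert2))}
    (hc : ∀ k < P.K, coverEntry2B P e P' e' k (cert.getD k (0, [])) = true)
    (hc' : ∀ k' < P'.K, coverEntry2B P' e' P e k' (cert'.getD k' (0, [])) = true)
    {t t' : ℝ} (ht : clock P.T0 P.Tau t = endVal e) (ht' : clock P'.T0 P'.Tau t' = endVal e')
    {z : E²} (hQ : ∀ j, 0 ≤ z j ∧ z j ≤ 1) : P.scalar G t z = P'.scalar G t' z := by
  by_cases h1 : ∃ k < P.K, (t, z) ∈ P.chain.tubeBox k ∩ P.Band k ∧ P.Θ G k t z ≠ 0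
  · obtain ⟨k, hk, hp, hne⟩ := h1
    exact (scalar_eq_of_coverEntry2 hGP hGP' hv hg hsep hA hv' hg' hsep' hA' hs hs' hk (hc k hk) ht ht' hQ hp hne).symm
  · push Not at h1
    have hP0 : P.scalar G t z = 0 := by
      by_cases h2 : ∃ k < P.K, (t, z) ∈ P.chain.tubeBox k ∩ P.Band k
      · obtain ⟨k, hk, hp⟩ := h2
        rw [scalar_eq_elem2 hg hsep hA hk hQ hp]; exact h1 k hk hp
      · push Not at h2
        exact scalar_eq_zero_off2 hGP.smooth hGP.bound hGP.nonneg hGP.supp hv hg hsep h2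
    by_cases h3 : ∃ k' < P'.K, (t', z) ∈ P'.chain.tubeBox k' ∩ P'.Band k' ∧ P'.Θ G k' t' z ≠ 0
    · obtain ⟨k', hk', hp', hne'⟩ := h3
      have := scalar_eq_of_coverEntry2 hGP' hGP hv' hg' hsep' hA' hv hg hsep hA hs' hs hk' (hc' k' hk') ht' ht hQ hp' hne'
      rw [this]
    · push Not at h3
      have hP'0 : P'.scalar G t' z = 0 := by
        by_cases h4 : ∃ k' < P'.K, (t', z) ∈ P'.chain.tubeBox k' ∩ P'.Band k'
        · obtain ⟨k', hk', hp'⟩ := h4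
          rw [scalar_eq_elem2 hg' hsep' hA' hk' hQ hp']; exact h3 k' hk' hp'
        · push Not at h4
          exact scalar_eq_zero_off2 hGP'.smooth hGP'.bound hGP'.nonneg hGP'.supp hv' hg' hsep' h4
      rw [hP0, hP'0]

/-- **Outside the closed square the assembled scalar is carried by the two end nodes.** [folklore] -/
theorem scalar_eq_ends2 (hg : P.geoPhase.geomB = true) (hsep : P.geoPhase.boxSepB = true) {e : Bool}
    (hm : P.geoPhase.middleInSqB e = true) (hK : 2 ≤ P.K) (G : ℝ → ℝ) {t : ℝ} (ht : clock P.T0 P.Tau t = endVal e) {z : E²}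
    (hQ : ¬ ∀ j, 0 ≤ z j ∧ z j ≤ 1) :
    P.scalar G t z = P.chain.chi 0 t z * P.Θ G 0 t z + P.chain.chi (P.K - 1) t z * P.Θ G (P.K - 1) t z := by
  have hW : P.chain.WFBd P.Band := PhaseQ.wfbd_of_geomB hg hsep
  have hKc : P.chain.K = P.K := by simp
  rw [PhaseQ2.scalar, assembledScalar_apply, hKc]
  refine sum_range_eq_pair2 (by omega) (by omega) (by omega) _ fun j hj h0 h1 => ?_
  have hin : ((P.node j).box.suppRect e).subsetB RectQ.unitSq = true := by
    have := List.all_eq_true.1 hm j (List.mem_range.2 (by simpa using hj))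
    simp only [Bool.or_eq_true, decide_eq_true_eq, geoPhase_node, NodeQ2.geo_box, geoPhase_K] at this
    rcases this with (h | h) | h
    · exact absurd h h0
    · exact absurd (by omega : j = P.K - 1) h1
    · exact h
  have hz : z ∉ ((P.chain.box j).frz t).supp := by
    intro hz
    have eB : P.chain.box j = (P.node j).box.moving P.T0 P.Tau := by
      show P.geoPhase.chain.box j = _; rw [PhaseQ.chain_box, geoPhase_node]; rfl
    rw [eB, BoxQ.moving_frz] at hz
    have hz' : ((P.node j).box.suppRect e).mem z := by
      rw [BoxQ.mem_suppRect_iff, ← ht]; exact hz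
    exact hQ ((RectQ.mem_unitSq_iff z).1 (RectQ.mem_of_subsetB hin hz'))
  rw [hW.chi_eq_zero_of_not_mem (by rw [hKc]; exact hj) hz, zero_mul]

/-- **The first cut-offs of two phases with frozen-equal first nodes coincide** (read on the proxies). [folklore] -/
theorem chi_zero_eq2 {P' : PhaseQ2} {e e' : Bool} (hK : 2 ≤ P.K) (hK' : 2 ≤ P'.K)
    (hb : (P.node 0).box.frzEqB e (P'.node 0).box e' = true) (hs : (P.node 0).step.frzEqB e (P'.node 0).step e' = true)
    {t t' : ℝ} (ht : clock P.T0 P.Tau t = endVal e) (ht' : clock P'.T0 P'.Tau t' = endVal e') (z : E²) :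
    P.chain.chi 0 t z = P'.chain.chi 0 t' z := by
  have h := PhaseQ.chi_zero_eq (P := P.geoPhase) (P' := P'.geoPhase) (e := e) (e' := e') (by simpa using hK) (by simpa using hK')
    (by simpa using hb) (by simpa using hs) ht ht' z
  exact h

/-- **The last cut-offs of two phases with frozen-equal last nodes coincide** (read on the proxies). [folklore] -/
theorem chi_last_eq2 {P' : PhaseQ2} {e e' : Bool} (hK : 2 ≤ P.K) (hK' : 2 ≤ P'.K)
    (hb : (P.node (P.K - 1)).box.frzEqB e (P'.node (P'.K - 1)).box e' = true)
    (hs : (P.node (P.K - 2)).step.frzEqB e (P'.node (P'.K - 2)).step e' = true)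
    {t t' : ℝ} (ht : clock P.T0 P.Tau t = endVal e) (ht' : clock P'.T0 P'.Tau t' = endVal e') (z : E²) :
    P.chain.chi (P.K - 1) t z = P'.chain.chi (P'.K - 1) t' z := by
  have h := PhaseQ.chi_last_eq (P := P.geoPhase) (P' := P'.geoPhase) (e := e) (e' := e') (by simpa using hK) (by simpa using hK')
    (by simpa using hb) (by simpa using hs) ht ht' z
  simp only [geoPhase_K] at h
  exact h

/-- **The re-description theorem, scalar part** (second layer). [folklore] -/
theorem scalar_eq_of_redescribeB2 {G : ℝ → ℝ} {M : ℝ} {P' : PhaseQ2} (hGP : PhaseQ.ProfileHyp G M P.r₀) (hGP' : PhaseQ.ProfileHyp G M P'.r₀)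
    (hv : P.elemsValidB = true) (hg : P.geoPhase.geomB = true) (hsep : P.geoPhase.boxSepB = true) (hA : P.JAgree2 G)
    (hv' : P'.elemsValidB = true) (hg' : P'.geoPhase.geomB = true) (hsep' : P'.geoPhase.boxSepB = true) (hA' : P'.JAgree2 G)
    {e e' : Bool} {cert cert' : List (Fin 2 × List (ℕ × EquivCert2))}
    (hc : redescribeB2 P e P' e' cert cert' = true) {t t' : ℝ} (ht : clock P.T0 P.Tau t = endVal e) (ht' : clock P'.T0 P'.Tau t' = endVal e') :
    P.scalar G t = P'.scalar G t' := by
  simp only [redescribeB2, Bool.and_eq_true, List.all_eq_true, List.mem_range, decide_eq_true_eq] at hc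
  obtain ⟨⟨⟨⟨⟨⟨⟨⟨hs, hs'⟩, hm⟩, hm'⟩, hend⟩, _⟩, _⟩, hcov⟩, hcov'⟩ := hc
  funext z
  by_cases hQ : ∀ j, 0 ≤ z j ∧ z j ≤ 1
  · exact scalar_eq_of_covers_sq2 hGP hGP' hv hg hsep hA hv' hg' hsep' hA' hs hs' hcov hcov' ht ht' hQ
  · simp only [endNodesEq2B, Bool.and_eq_true, decide_eq_true_eq, Bool.not_eq_true'] at hend
    obtain ⟨⟨⟨⟨⟨⟨⟨⟨⟨⟨⟨hK, hK'⟩, hn0⟩, hn0'⟩, hn1⟩, hn1'⟩, hb0⟩, he0⟩, hs0⟩, hb1⟩, he1⟩, hs1⟩ := hend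
    have h0 : P.Θ G 0 t z = P'.Θ G 0 t' z := by
      simp only [PhaseQ2.Θ]
      rw [ElemQ2.scalar_eq_toElemQ_of_not_isSheared hn0, ElemQ2.scalar_eq_toElemQ_of_not_isSheared hn0']
      exact ElemQ.scalar_eq_of_equivB he0 G ht ht' z
    have h1 : P.Θ G (P.K - 1) t z = P'.Θ G (P'.K - 1) t' z := by
      simp only [PhaseQ2.Θ]
      rw [ElemQ2.scalar_eq_toElemQ_of_not_isSheared hn1, ElemQ2.scalar_eq_toElemQ_of_not_isSheared hn1']
      exact ElemQ.scalar_eq_of_equivB he1 G ht ht' z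
    rw [scalar_eq_ends2 hg hsep hm hK G ht hQ, scalar_eq_ends2 hg' hsep' hm' hK' G ht' hQ,
      chi_zero_eq2 hK hK' hb0 hs0 ht ht', chi_last_eq2 hK hK' hb1 hs1 ht ht', h0, h1]

/-- **The re-description theorem on a common flat window** (second layer). [folklore] -/
theorem fields_eq_of_redescribeB2 {G : ℝ → ℝ} {M : ℝ} {P' : PhaseQ2} (hGP : PhaseQ.ProfileHyp G M P.r₀) (hGP' : PhaseQ.ProfileHyp G M P'.r₀)
    (hv : P.elemsValidB = true) (hg : P.geoPhase.geomB = true) (hsep : P.geoPhase.boxSepB = true) (hA : P.JAgree2 G)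
    (hv' : P'.elemsValidB = true) (hg' : P'.geoPhase.geomB = true) (hsep' : P'.geoPhase.boxSepB = true) (hA' : P'.JAgree2 G)
    {e e' : Bool} {cert cert' : List (Fin 2 × List (ℕ × EquivCert2))}
    (hc : redescribeB2 P e P' e' cert cert' = true) {t : ℝ} (ht : clock P.T0 P.Tau t = endVal e) (ht' : clock P'.T0 P'.Tau t = endVal e')
    (hd : clockDeriv P.T0 P.Tau t = 0) (hd' : clockDeriv P'.T0 P'.Tau t = 0) :
    P.scalar G t = P'.scalar G t ∧ P.velocity t = P'.velocity t :=
  ⟨scalar_eq_of_redescribeB2 hGP hGP' hv hg hsep hA hv' hg' hsep' hA' hc ht ht', velocity_eq_of_clockDeriv P P' hd hd'⟩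

end PhaseQ2

end PlanarKinematics

end Literature.Analysis.FluidPDE
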